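import Mathlib
import Literature.NumberTheory.DiophantineGeometry.PartitionTableaux
import Literature.NumberTheory.DiophantineGeometry.StandardFillings
import Literature.RepresentationTheory.FiniteGroups.VershikKerovBoundaryWord
import Literature.NumberTheory.DiophantineGeometry.FirstRowPeeling
import Literature.NumberTheory.DiophantineGeometry.SymmetricGroupRepsSignTwist
import Literature.NumberTheory.DiophantineGeometry.SymmetricGroupRepsFinrankSpechtProofs
import Literature.NumberTheory.DiophantineGeometry.SymmetricGroupReps
import Literature.Computability.AlgebraicComplexity.BLMW11StanleyRectangularCharacterProofs
import Literature.Computability.Complexity.OccurrenceObstructionsIP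
import Literature.RepresentationTheory.FiniteGroups.AlternatingGroupMinimalDegree
import Literature.RepresentationTheory.FiniteGroups.IndexTwoRestriction
import Literature.RepresentationTheory.FiniteGroups.CliffordCorrespondence
import Literature.RepresentationTheory.FiniteGroups.InducedCharacter
import Literature.RepresentationTheory.FiniteGroups.SymmetricGroupIsotypic
import Literature.GroupTheory.QuasirandomGroups.AlternatingProductMixingProofs
import Literature.RepresentationTheory.FiniteGroups.SymmetricGroupHookCharacters
import HarnessLib

/-!
# `JamesKerber1981_thm_2_5_15` and `alternatingProductMixing` HOLD — the minimal degree of `𝔄_n` is `n − 1` (Specht dimension bounds + Clifford theory) and product mixing in `𝔄_n` (re-homed proofs)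

Family `valiant` / `matmult` material RE-HOMED into `Literature/` by the Hodge foundations lane (`lit-hodgefound`, seat p20,
generation 35): verbatim ports, in dependency order and each with its original module docstring, of
`Summits/MatrixMultiplication/MatrixMultiplication/Theorems/SnSubsetDichotomyPolynomialSlack{SpechtBranching, SpechtDimLower}.lean`
(Parts 1–2), `Summits/ValiantsHypothesis/ValiantsHypothesis/Theorems/{SymPencilEquivariantSdcNotQPYoungDegreeBoundPrelim,
MonotoneRestorationMixingScaleSpechtDimLinear, MonotoneRestorationMixingScaleSpechtDimSelfConjugate}.lean` (Parts 3–5) and the apex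
`Summits/ValiantsHypothesis/ValiantsHypothesis/Theorems/MonotoneRestorationMixingScaleAlternatingMinimalDegree.lean` (Part 6; route
MonotoneRestoration, crux `OrbitRestorationQP`, line `mixing-scale`), namespaces re-rooted
`Summit.MatrixMultiplication.MatrixMultiplication.Theorems.PolynomialSlack` ↦ `Literature.RepresentationTheory.FiniteGroups.SpechtPolynomialSlack`,
`Summit.ValiantsHypothesis.ValiantsHypothesis.Theorems.SymPencilEquivariantSdcNotQP.YoungBounds` ↦ `Literature.RepresentationTheory.FiniteGroups.YoungBounds`,
`…Theorems.OrbitRestorationQPMixingScale.{SpechtDim, AlternatingMinimalDegree}` ↦ `Literature.RepresentationTheory.FiniteGroups.{SpechtDim, AlternatingMinimalDegree}`;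
theorems only (no definition, no named fact), imports Literature/Mathlib only; all `[folklore]` helpers privatised (hence ONE
file: the Specht-dimension layer of Parts 1–5 is used only by Part 6).  The sibling Summits module
`SnSubsetDichotomyPolynomialSlackHookCharacters` is NOT ported: its content already lives in `Literature/` as
`RepresentationTheory/FiniteGroups/SymmetricGroupHookCharacters.lean` (namespace `Literature.RepresentationTheory.FiniteGroups`; the four
lemmas Part 6 uses — `sortedParts_of_card_parts_ge`, `sortedParts_of_exists_large_part`, `spechtCharacter_of_sortedParts_eq_column`,
`spechtCharacter_of_sortedParts_eq_single` — have identical statements there).  Part 6's two apex theorems are renamed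
(`jamesKerber_minDegree_of_spechtDim`, `alternatingProductMixing_of_jamesKerber`) so that Part 7 can carry the EXACT discharge names of
record `Literature.RepresentationTheory.FiniteGroups.JamesKerber1981_thm_2_5_15_holds` (James–Kerber 1981 Thm. 2.5.15 (i)+(ii): for
`n ∉ {3,4,5}` every non-trivial irreducible complex representation of `𝔄_n` has dimension `≥ n − 1`; proof = Clifford theory of index
two (James–Liebeck Props. 20.5/20.9, the tree's `IndexTwoRestriction` / `CliffordCorrespondence`) over the Specht layer + the
dimension bounds `SpechtDim.linear_le_syt` (`f^μ ≥ n − 1` off the row and the column) and `SpechtDim.two_mul_le_syt_of_transpose_eq`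
(`f^μ ≥ 2(n − 1)` for self-conjugate `μ`, `n ≥ 6`)) and `Literature.GroupTheory.QuasirandomGroups.alternatingProductMixing_holds`
(product mixing in `𝔄_n`, Gowers 2008 Thm. 3.3 / Nikolov–Pyber 2011 Cor. 2, via the tree's PROVED reduction
`alternatingProductMixing_of_minDegree`).  Summits-side twins:
`Summit.ValiantsHypothesis.ValiantsHypothesis.Theorems.OrbitRestorationQPMixingScale.AlternatingMinimalDegree.{JamesKerber1981_thm_2_5_15_holds, alternatingProductMixing_holds}`.
The Summits originals stay in place (transitional duplication; cited here).  Nothing here is progress on `VP ≠ VNP` (the originals'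
honest framing stands).
-/

noncomputable section

/-!
## Part 1 — port of `Summits/MatrixMultiplication/MatrixMultiplication/Theorems/SnSubsetDichotomyPolynomialSlackSpechtBranching.lean`

# Standard tableaux of Young diagrams: transposition, corners and the branching inequalities

Helper file 1/2 of the quadratic lower bound for Specht dimensions used by the LEVEL-ONE programme on
the crux `SnSubsetDichotomy.PolynomialSlack` (stmt-MatrixMultiplication-8306). Writing `f^Y` for the
number of standard fillings of a Young diagram `Y` by `|Y|` entries (`StdFilling`, so that
`numStandardTableaux μ = f^{μ.youngDiagram}`):

* `exists_partition_youngDiagram_eq` — every diagram is the diagram of a partition (parts = row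
  lengths), hence `1 ≤ f^Y` (`one_le_card_stdFilling`);
* `card_stdFilling_transpose`, `numStandardTableaux_transpose` — `f^{Yᵀ} = f^Y`, `f^{μ'} = f^μ`;
* `le_syt_of_isCornerRow`, `add_le_syt_of_isCornerRow` — the branching INEQUALITIES `f^{Y ⊖ c} ≤ f^Y`
  and `f^{Y ⊖ c} + f^{Y ⊖ c'} ≤ f^Y` for corners `c ≠ c'` (from the tree's branching rule
  `StdFilling.card_stdFilling_succ`), where the corner of a row `r` with `rowLen (r+1) < rowLen r` is
  the cell `(r, rowLen r - 1)`;
* bookkeeping on first row / first column / size of `Y` and of `Y ⊖ c`.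

Reference for the branching rule: G. James, *The Representation Theory of the Symmetric Groups*,
LNM 682 (1978), §9; W. Fulton, *Young Tableaux* (1997), §7.2.
-/

section Part1

namespace Literature.RepresentationTheory.FiniteGroups.SpechtPolynomialSlack

open Literature.NumberTheory.DiophantineGeometry Literature.RepresentationTheory.FiniteGroups

-- `Summit.<Summit>.<Problem>` is the tree's mandated summit-side namespace (CONVENTIONS §2); for
/-! ## Young diagrams as partitions; the number of standard tableaux of a diagram -/

/-- Every Young diagram is the diagram of a partition of its size (parts = row lengths), with as
many parts as the first column has cells. [folklore] -/
private theorem exists_partition_youngDiagram_eq (Y : YoungDiagram) :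
    ∃ μ : Nat.Partition Y.cells.card, μ.youngDiagram = Y ∧ μ.parts.card = Y.colLen 0 := by
  let μ : Nat.Partition Y.cells.card :=
    { parts := (Y.rowLens : Multiset ℕ)
      parts_pos := fun h => Y.pos_of_mem_rowLens _ (Multiset.mem_coe.mp h)
      parts_sum := by rw [Multiset.sum_coe, YoungDiagram.sum_rowLens] }
  have hsorted : μ.sortedParts = Y.rowLens := by
    change Multiset.sort (Y.rowLens : Multiset ℕ) (· ≥ ·) = _
    rw [Multiset.coe_sort]
    exact List.mergeSort_eq_self _ (YoungDiagram.rowLens_sorted _).pairwise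
  have key : ∀ (l₁ l₂ : List ℕ) (h₁ : l₁.SortedGE) (h₂ : l₂.SortedGE), l₁ = l₂ →
      YoungDiagram.ofRowLens l₁ h₁ = YoungDiagram.ofRowLens l₂ h₂ := by
    rintro l₁ l₂ h₁ h₂ rfl; rfl
  refine ⟨μ, (key _ _ _ (YoungDiagram.rowLens_sorted _) hsorted).trans
    YoungDiagram.ofRowLens_to_rowLens_eq_self, ?_⟩
  change (Y.rowLens : Multiset ℕ).card = _
  rw [Multiset.coe_card, YoungDiagram.length_rowLens]

/-- `f^μ` is the number of standard fillings of the diagram of `μ` by `|diagram|` entries. [folklore] -/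
private theorem numStandardTableaux_eq_card_stdFilling' {d : ℕ} (μ : Nat.Partition d) :
    numStandardTableaux μ = Nat.card (StdFilling μ.youngDiagram.cells.card μ.youngDiagram) := by
  rw [numStandardTableaux_eq_card_stdFilling, μ.card_cells_youngDiagram]

/-- Every diagram has a standard tableau. [folklore] -/
private theorem one_le_card_stdFilling (Y : YoungDiagram) : 1 ≤ Nat.card (StdFilling Y.cells.card Y) := by
  obtain ⟨μ, hμ, -⟩ := exists_partition_youngDiagram_eq Y
  have h := numStandardTableaux_pos_holds μ
  rwa [numStandardTableaux_eq_card_stdFilling', hμ] at h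

/-! ## Transposition -/

/-- **`f^{λ'} = f^{λ}`**: transposing standard fillings (swap the coordinates of every entry) is a
bijection, so `Yᵀ` has as many standard fillings as `Y`. [folklore] -/
private theorem card_stdFilling_transpose (n : ℕ) (Y : YoungDiagram) :
    Nat.card (StdFilling n Y.transpose) = Nat.card (StdFilling n Y) := by
  refine (Nat.card_congr (?_ : StdFilling n Y ≃ StdFilling n Y.transpose)).symm
  exact
    { toFun := fun T => ⟨fun p => (T.1 p).swap,
        ⟨fun p => YoungDiagram.mem_transpose.2 (by rw [Prod.swap_swap]; exact T.mem p),
          fun p q h => T.injective (Prod.swap_injective h),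
          fun p q h hle => T.not_le h (Prod.swap_le_swap.1 hle)⟩⟩
      invFun := fun T => ⟨fun p => (T.1 p).swap,
        ⟨fun p => YoungDiagram.mem_transpose.1 (T.mem p),
          fun p q h => T.injective (Prod.swap_injective h),
          fun p q h hle => T.not_le h (Prod.swap_le_swap.1 hle)⟩⟩
      left_inv := fun T => by apply StdFilling.ext; funext p; simp
      right_inv := fun T => by apply StdFilling.ext; funext p; simp }

/-- `f^{Yᵀ} = f^{Y}` with `|Yᵀ| = |Y|` entries. [folklore] -/
private theorem card_stdFilling_transpose' (Y : YoungDiagram) :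
    Nat.card (StdFilling Y.transpose.cells.card Y.transpose) = Nat.card (StdFilling Y.cells.card Y) := by
  rw [YoungDiagram.card_transpose, card_stdFilling_transpose]

/-- `f^{μ'} = f^{μ}` for partitions. [folklore] -/
private theorem numStandardTableaux_transpose {d : ℕ} (μ : Nat.Partition d) :
    numStandardTableaux μ.transpose = numStandardTableaux μ := by
  rw [numStandardTableaux_eq_card_stdFilling', numStandardTableaux_eq_card_stdFilling',
    μ.youngDiagram_transpose, card_stdFilling_transpose']

/-! ## Corners and the branching inequalities -/

/-- The corner cell of a corner row lies in the diagram. [folklore] -/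
private theorem cornerCell_mem {Y : YoungDiagram} {r : ℕ} (h : (Y.rowLen (r + 1) < Y.rowLen r)) : (r, Y.rowLen r - 1) ∈ Y.cells :=
  (YoungDiagram.mem_cells _).2 (YoungDiagram.mem_iff_lt_rowLen.2 (by omega))

/-- Removing a corner: the number of cells drops by one, so if `|Y| = n + 1` then `|Y ⊖ c| = n`.
[folklore] -/
private theorem card_removeAbove_cornerCell {Y : YoungDiagram} {r n : ℕ} (h : (Y.rowLen (r + 1) < Y.rowLen r))
    (hY : Y.cells.card = n + 1) : (Y.removeAbove ((r, Y.rowLen r - 1))).cells.card = n := by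
  rw [YoungDiagram.card_removeAbove_corner h, hY]; rfl

/-- A diagram with a corner row is non-empty: `|Y| = n + 1` for some `n`. [folklore] -/
private theorem exists_card_eq_succ_of_isCornerRow {Y : YoungDiagram} {r : ℕ} (h : (Y.rowLen (r + 1) < Y.rowLen r)) :
    ∃ n, Y.cells.card = n + 1 :=
  Nat.exists_eq_add_one_of_ne_zero (Finset.card_ne_zero_of_mem (cornerCell_mem h))

/-- **Branching inequality, one corner**: `f^{Y ⊖ c} ≤ f^{Y}` for a corner `c`. [folklore] -/
private theorem le_syt_of_isCornerRow {Y : YoungDiagram} {r : ℕ} (h : (Y.rowLen (r + 1) < Y.rowLen r)) :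
    Nat.card (StdFilling (Y.removeAbove ((r, Y.rowLen r - 1))).cells.card (Y.removeAbove ((r, Y.rowLen r - 1)))) ≤ Nat.card (StdFilling Y.cells.card Y) := by
  classical
  obtain ⟨n, hY⟩ := exists_card_eq_succ_of_isCornerRow h
  have hbranch := StdFilling.card_stdFilling_succ n Y
  have e1 : Nat.card (StdFilling Y.cells.card Y) = Nat.card (StdFilling (n + 1) Y) := by rw [hY]
  have e2 : Nat.card (StdFilling (Y.removeAbove ((r, Y.rowLen r - 1))).cells.card (Y.removeAbove ((r, Y.rowLen r - 1)))) =
      Nat.card (StdFilling n (Y.removeAbove ((r, Y.rowLen r - 1)))) := by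
    rw [card_removeAbove_cornerCell h hY]
  rw [e1, e2, hbranch]
  exact Finset.single_le_sum (f := fun c => Nat.card (StdFilling n (Y.removeAbove c)))
    (fun _ _ => Nat.zero_le _) (cornerCell_mem h)

/-- **Branching inequality, two corners**: `f^{Y ⊖ c} + f^{Y ⊖ c'} ≤ f^{Y}` for corners in distinct rows.
[folklore] -/
private theorem add_le_syt_of_isCornerRow {Y : YoungDiagram} {r r' : ℕ} (h : (Y.rowLen (r + 1) < Y.rowLen r))
    (h' : (Y.rowLen (r' + 1) < Y.rowLen r')) (hne : r ≠ r') :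
    Nat.card (StdFilling (Y.removeAbove ((r, Y.rowLen r - 1))).cells.card (Y.removeAbove ((r, Y.rowLen r - 1)))) + Nat.card (StdFilling (Y.removeAbove ((r', Y.rowLen r' - 1))).cells.card (Y.removeAbove ((r', Y.rowLen r' - 1)))) ≤ Nat.card (StdFilling Y.cells.card Y) := by
  classical
  obtain ⟨n, hY⟩ := exists_card_eq_succ_of_isCornerRow h
  have hbranch := StdFilling.card_stdFilling_succ n Y
  have e1 : Nat.card (StdFilling Y.cells.card Y) = Nat.card (StdFilling (n + 1) Y) := by rw [hY]
  have e2 : Nat.card (StdFilling (Y.removeAbove ((r, Y.rowLen r - 1))).cells.card (Y.removeAbove ((r, Y.rowLen r - 1)))) =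
      Nat.card (StdFilling n (Y.removeAbove ((r, Y.rowLen r - 1)))) := by
    rw [card_removeAbove_cornerCell h hY]
  have e3 : Nat.card (StdFilling (Y.removeAbove ((r', Y.rowLen r' - 1))).cells.card (Y.removeAbove ((r', Y.rowLen r' - 1)))) =
      Nat.card (StdFilling n (Y.removeAbove ((r', Y.rowLen r' - 1)))) := by
    rw [card_removeAbove_cornerCell h' hY]
  have hcc : (r, Y.rowLen r - 1) ≠ (r', Y.rowLen r' - 1) := fun e => hne (congrArg Prod.fst e)
  rw [e1, e2, e3, hbranch]
  have hsub : ({(r, Y.rowLen r - 1), (r', Y.rowLen r' - 1)} : Finset (ℕ × ℕ)) ⊆ Y.cells := by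
    intro c hc
    rcases Finset.mem_insert.1 hc with rfl | hc
    · exact cornerCell_mem h
    · rw [Finset.mem_singleton.1 hc]; exact cornerCell_mem h'
  calc Nat.card (StdFilling n (Y.removeAbove ((r, Y.rowLen r - 1)))) +
        Nat.card (StdFilling n (Y.removeAbove ((r', Y.rowLen r' - 1))))
      = ∑ c ∈ ({(r, Y.rowLen r - 1), (r', Y.rowLen r' - 1)} : Finset (ℕ × ℕ)),
          Nat.card (StdFilling n (Y.removeAbove c)) := by
        rw [Finset.sum_insert (by rwa [Finset.mem_singleton]), Finset.sum_singleton]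
    _ ≤ _ := Finset.sum_le_sum_of_subset_of_nonneg hsub fun _ _ _ => Nat.zero_le _

/-! ## Shape bookkeeping: first row, first column, size -/

section Shape

variable {Y : YoungDiagram}

/-- Rows above the first column length are non-empty. [folklore] -/
private theorem one_le_rowLen_of_lt_colLen {r : ℕ} (h : r < Y.colLen 0) : 1 ≤ Y.rowLen r :=
  YoungDiagram.mem_iff_lt_rowLen.1 (YoungDiagram.mem_iff_lt_colLen.2 h)

/-- The last row is a corner row. [folklore] -/
private theorem isCornerRow_last (h : 1 ≤ Y.colLen 0) : (Y.rowLen (Y.colLen 0 - 1 + 1) < Y.rowLen (Y.colLen 0 - 1)) := by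
  rw [VershikKerov.rowLen_eq_zero _ (by omega)]
  exact one_le_rowLen_of_lt_colLen (by omega)

/-- The size of a diagram is the sum of its row lengths over the rows `r < colLen 0`. [folklore] -/
private theorem card_eq_sum_rowLen (Y : YoungDiagram) :
    Y.cells.card = ∑ r ∈ Finset.range (Y.colLen 0), Y.rowLen r := by
  rw [← YoungDiagram.sum_rowLens, YoungDiagram.rowLens, ← List.sum_toFinset _ (List.nodup_range),
    List.toFinset_range]

/-- A non-empty diagram has a non-empty first column. [folklore] -/
private theorem one_le_colLen_of_card_pos (h : 0 < Y.cells.card) : 1 ≤ Y.colLen 0 := by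
  by_contra h0
  rw [card_eq_sum_rowLen, show Y.colLen 0 = 0 by omega, Finset.range_zero, Finset.sum_empty] at h
  exact lt_irrefl _ h

/-- A single-column diagram: if the first row has length `≤ 1` then `|Y| = colLen 0`. [folklore] -/
private theorem card_eq_colLen_of_rowLen_le_one (h : Y.rowLen 0 ≤ 1) : Y.cells.card = Y.colLen 0 := by
  rw [card_eq_sum_rowLen]
  calc ∑ r ∈ Finset.range (Y.colLen 0), Y.rowLen r = ∑ r ∈ Finset.range (Y.colLen 0), 1 := by
        refine Finset.sum_congr rfl fun r hr => le_antisymm ?_ (one_le_rowLen_of_lt_colLen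
          (Finset.mem_range.1 hr))
        exact (Y.rowLen_anti 0 r (Nat.zero_le _)).trans h
    _ = Y.colLen 0 := by simp

/-- A single-row diagram: if the first column has length `≤ 1` then `|Y| = rowLen 0`. [folklore] -/
private theorem card_eq_rowLen_of_colLen_le_one (h : Y.colLen 0 ≤ 1) : Y.cells.card = Y.rowLen 0 := by
  rw [card_eq_sum_rowLen]
  rcases Nat.eq_zero_or_pos (Y.colLen 0) with h0 | h0
  · rw [h0, Finset.range_zero, Finset.sum_empty, VershikKerov.rowLen_eq_zero _ (by omega)]
  · rw [show Y.colLen 0 = 1 by omega, Finset.sum_range_one]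

/-- In a rectangle-free-of-corners situation: if no row `r < colLen 0 - 1` is a corner row, all rows
have the length of the first row. [folklore] -/
private theorem rowLen_eq_rowLen_zero_of_no_corner (h : ∀ r, r + 1 < Y.colLen 0 → ¬ (Y.rowLen (r + 1) < Y.rowLen r))
    {r : ℕ} (hr : r < Y.colLen 0) : Y.rowLen r = Y.rowLen 0 := by
  induction r with
  | zero => rfl
  | succ r ih =>
    have h1 := ih (by omega)
    have h2 : ¬ (Y.rowLen (r + 1) < Y.rowLen r) := h r (by omega)
    have h3 := Y.rowLen_anti r (r + 1) (Nat.le_succ r)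
    omega

/-- A rectangle: if every row `r < colLen 0` has length `rowLen 0` then `|Y| = rowLen 0 * colLen 0`.
[folklore] -/
private theorem card_eq_mul_of_rect (h : ∀ r, r < Y.colLen 0 → Y.rowLen r = Y.rowLen 0) :
    Y.cells.card = Y.rowLen 0 * Y.colLen 0 := by
  rw [card_eq_sum_rowLen]
  calc ∑ r ∈ Finset.range (Y.colLen 0), Y.rowLen r
      = ∑ r ∈ Finset.range (Y.colLen 0), Y.rowLen 0 :=
        Finset.sum_congr rfl fun r hr => h r (Finset.mem_range.1 hr)
    _ = Y.rowLen 0 * Y.colLen 0 := by rw [Finset.sum_const, Finset.card_range, smul_eq_mul, mul_comm]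

/-- Row lengths are monotone in the diagram. [folklore] -/
private theorem rowLen_le_of_le {Y Z : YoungDiagram} (h : Y ≤ Z) (i : ℕ) : Y.rowLen i ≤ Z.rowLen i := by
  by_contra hlt
  have hmem : (i, Z.rowLen i) ∈ Y := YoungDiagram.mem_iff_lt_rowLen.2 (by omega)
  exact absurd (YoungDiagram.mem_iff_lt_rowLen.1 (h hmem)) (lt_irrefl _)

/-- Column lengths are monotone in the diagram. [folklore] -/
private theorem colLen_le_of_le {Y Z : YoungDiagram} (h : Y ≤ Z) (j : ℕ) : Y.colLen j ≤ Z.colLen j := by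
  by_contra hlt
  have hmem : (Z.colLen j, j) ∈ Y := YoungDiagram.mem_iff_lt_colLen.2 (by omega)
  exact absurd (YoungDiagram.mem_iff_lt_colLen.1 (h hmem)) (lt_irrefl _)

/-- `Y ⊖ c ≤ Y`. [folklore] -/
private theorem removeAbove_le (Y : YoungDiagram) (c : ℕ × ℕ) : Y.removeAbove c ≤ Y :=
  fun _ hx => YoungDiagram.mem_of_mem_removeAbove hx

/-- Removing the corner of row `r` shortens row `r` by one. [folklore] -/
private theorem rowLen_removeAbove_cornerCell_self {r : ℕ} (h : (Y.rowLen (r + 1) < Y.rowLen r)) :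
    (Y.removeAbove ((r, Y.rowLen r - 1))).rowLen r = Y.rowLen r - 1 :=
  YoungDiagram.rowLen_removeAbove_corner_self h

/-- Removing the corner of row `r` keeps the other rows. [folklore] -/
private theorem rowLen_removeAbove_cornerCell_of_ne {r i : ℕ} (h : (Y.rowLen (r + 1) < Y.rowLen r)) (hi : i ≠ r) :
    (Y.removeAbove ((r, Y.rowLen r - 1))).rowLen i = Y.rowLen i :=
  YoungDiagram.rowLen_removeAbove_corner_of_ne h hi

end Shape

end Literature.RepresentationTheory.FiniteGroups.SpechtPolynomialSlack

end Part1

/-!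
## Part 2 — port of `Summits/MatrixMultiplication/MatrixMultiplication/Theorems/SnSubsetDichotomyPolynomialSlackSpechtDimLower.lean`

# A quadratic lower bound for the dimensions of the non-linear, non-standard Specht modules

Helper file 2/2 (after `…SpechtBranching`) for the LEVEL-ONE programme on the crux
`SnSubsetDichotomy.PolynomialSlack` (stmt-MatrixMultiplication-8306): the Wedderburn blocks of `ℂ[S_n]`
other than the four of level `≤ 1` — the partitions `(n)`, `(1ⁿ)`, `(n-1,1)`, `(2,1^{n-2})` — have
dimension `f^μ ≫ n`, so that in the dissected BCGPU identity they are negligible up to volume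
`(n!)^{3/2}/n^{1-o(1)}`.

Main result: `quadratic_le_numStandardTableaux` — **for `n ≥ 40` and every partition `μ ⊢ n` all of
whose parts are `≤ n - 2` and which has at most `n - 2` parts, `n(n-1) ≤ 6 f^μ`** (indeed
`C(n,2)/e ≤ f^μ`, `choose_div_exp_le_numStandardTableaux`). The sharp statement is Rasala's: the
minimum is `f^{(n-2,2)} = n(n-3)/2` for `n ≥ 9` [Rasala 1977, Thm. A]; the weak form here is proved by a
self-starting strong induction on `n` over Young diagrams (`sytBound_le_syt`) with the potential
`𝔅 m = min (C(m,2)/e, 2^{⌊(m-12)/2⌋})` (free for `m ≤ 12`): two corner rows double the bound, a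
rectangle doubles it over two steps through its unique child, and a first row (or, transposing, first
column) of exactly `m - 2` cells is bounded directly by the tree's long-first-row inequality
`C(n,j) f^ν ≤ e f^μ` (`choose_mul_numStandardTableaux_le_exp_mul`, with `j = 2`).

References: R. Rasala, *On the minimal degrees of characters of `S_n`*, J. Algebra 45 (1977)
132–181; G. James, *The Representation Theory of the Symmetric Groups*, LNM 682, §9 (branching).
-/

section Part2

namespace Literature.RepresentationTheory.FiniteGroups.SpechtPolynomialSlack

open Literature.NumberTheory.DiophantineGeometry Literature.RepresentationTheory.FiniteGroups

-- `Summit.<Summit>.<Problem>` is the tree's mandated summit-side namespace (CONVENTIONS §2); for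
/-! ## The long-first-row bound: `a = |Y| - 2` gives `C(|Y|,2)/e ≤ f^Y` -/

/-- The first row length is the head of `rowLens`. [folklore] -/
private theorem head?_rowLens {Y : YoungDiagram} (h : 1 ≤ Y.colLen 0) : Y.rowLens.head? = some (Y.rowLen 0) := by
  obtain ⟨k, hk⟩ : ∃ k, Y.colLen 0 = k + 1 := ⟨Y.colLen 0 - 1, by omega⟩
  rw [YoungDiagram.rowLens, hk, List.range_succ_eq_map]
  rfl

/-- **Near-hook shapes, directly.** If the first row of `Y` has exactly `|Y| - 2` cells and `|Y| ≥ 6`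
then `C(|Y|, 2)/e ≤ f^Y` (the tree's long-first-row inequality `C(n,j) f^ν ≤ e f^μ` with `j = 2`).
[folklore] -/
private theorem choose_div_exp_le_syt_of_rowLen {Y : YoungDiagram} (h6 : 6 ≤ Y.cells.card)
    (ha : Y.rowLen 0 + 2 = Y.cells.card) :
    ((Y.cells.card).choose 2 : ℝ) / Real.exp 1 ≤ Nat.card (StdFilling Y.cells.card Y) := by
  obtain ⟨μ, hμY, -⟩ := exists_partition_youngDiagram_eq Y
  have hn : Y.cells.card ≠ 0 := by omega
  obtain ⟨ν, hs⟩ := exists_sortedParts_eq_sup_cons μ hn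
  -- the largest part is the first row
  have hcol : 1 ≤ Y.colLen 0 := one_le_colLen_of_card_pos (by omega)
  have hsup : μ.parts.sup = Y.rowLen 0 := by
    have h1 : Y.rowLens.head? = some μ.parts.sup := by
      have e : μ.youngDiagram.rowLens = μ.parts.sup :: ν.sortedParts := by
        rw [μ.rowLens_youngDiagram, hs]
      rw [hμY] at e
      rw [e]; rfl
    rw [head?_rowLens hcol] at h1
    exact (Option.some_injective _ h1).symm
  have hj : 2 * (Y.cells.card - μ.parts.sup) ≤ μ.parts.sup := by rw [hsup]; omega
  have key := choose_mul_numStandardTableaux_le_exp_mul hs hj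
  have eμ : (numStandardTableaux μ : ℝ) = Nat.card (StdFilling Y.cells.card Y) := by
    rw [numStandardTableaux_eq_card_stdFilling]
    -- `μ.youngDiagram = Y` and `|Y|` is the index
    have : Nat.card (StdFilling Y.cells.card μ.youngDiagram) = Nat.card (StdFilling Y.cells.card Y) := by
      rw [hμY]
    exact_mod_cast this
  rw [eμ] at key
  have hν : (1 : ℝ) ≤ numStandardTableaux ν := by exact_mod_cast numStandardTableaux_pos_holds ν
  have hchoose : (Y.cells.card).choose (Y.cells.card - μ.parts.sup) = (Y.cells.card).choose 2 := by
    rw [hsup, show Y.cells.card - Y.rowLen 0 = 2 by omega]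
  rw [hchoose] at key
  rw [div_le_iff₀ (Real.exp_pos 1)]
  have h0 : (0 : ℝ) ≤ (Y.cells.card).choose 2 := Nat.cast_nonneg _
  calc ((Y.cells.card).choose 2 : ℝ) = (Y.cells.card).choose 2 * 1 := (mul_one _).symm
    _ ≤ (Y.cells.card).choose 2 * numStandardTableaux ν := mul_le_mul_of_nonneg_left hν h0
    _ ≤ Real.exp 1 * Nat.card (StdFilling Y.cells.card Y) := key
    _ = Nat.card (StdFilling Y.cells.card Y) * Real.exp 1 := mul_comm _ _

/-! ## The potential of the induction -/

/-- The potential is at most `1` for `m ≤ 12` (free base of the induction). [folklore] -/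
private theorem sytBound_le_one {m : ℕ} (hm : m ≤ 12) : min ((Nat.choose m 2 : ℝ) / Real.exp 1) ((2 : ℝ) ^ ((m - 12) / 2)) ≤ 1 := by
  rw [show (m - 12) / 2 = 0 by omega, pow_zero]
  exact min_le_right _ _

/-- The potential is at most its quadratic component. [folklore] -/
private theorem sytBound_le_choose (m : ℕ) : min ((Nat.choose m 2 : ℝ) / Real.exp 1) ((2 : ℝ) ^ ((m - 12) / 2)) ≤ (m.choose 2 : ℝ) / Real.exp 1 := min_le_left _ _

/-- `C(n+1, 2) = n + C(n, 2)`. [folklore] -/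
private theorem choose_two_succ (n : ℕ) : (n + 1).choose 2 = n + n.choose 2 := by
  rw [Nat.choose_succ_succ, Nat.choose_one_right]

/-- `n ≤ C(n,2)` for `n ≥ 3`. [folklore] -/
private theorem le_choose_two {n : ℕ} (hn : 3 ≤ n) : n ≤ n.choose 2 := by
  obtain ⟨k, rfl⟩ : ∃ k, n = k + 3 := ⟨n - 3, by omega⟩
  induction k with
  | zero => decide
  | succ k ih =>
    rw [show k + 1 + 3 = (k + 3) + 1 by ring, choose_two_succ]
    omega

/-- `C(m,2) ≤ 2·C(m-1,2)` for `m ≥ 4`. [folklore] -/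
private theorem choose_two_le_two_mul_pred {m : ℕ} (hm : 4 ≤ m) : m.choose 2 ≤ 2 * (m - 1).choose 2 := by
  obtain ⟨n, rfl⟩ : ∃ n, m = n + 1 := ⟨m - 1, by omega⟩
  rw [choose_two_succ, Nat.add_sub_cancel]
  have := le_choose_two (show 3 ≤ n by omega)
  omega

/-- `C(m,2) ≤ 2·C(m-2,2)` for `m ≥ 8`. [folklore] -/
private theorem choose_two_le_two_mul_pred_pred {m : ℕ} (hm : 8 ≤ m) : m.choose 2 ≤ 2 * (m - 2).choose 2 := by
  obtain ⟨n, rfl⟩ : ∃ n, m = n + 2 := ⟨m - 2, by omega⟩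
  rw [show n + 2 = (n + 1) + 1 by ring, choose_two_succ, choose_two_succ,
    show n + 1 + 1 - 2 = n by omega]
  -- need `(n+1) + n ≤ C(n,2)` for `n ≥ 6`
  have key : ∀ k, 6 ≤ k → 2 * k + 1 ≤ k.choose 2 := by
    intro k hk
    obtain ⟨j, rfl⟩ : ∃ j, k = j + 6 := ⟨k - 6, by omega⟩
    induction j with
    | zero => decide
    | succ j ih =>
      rw [show j + 1 + 6 = (j + 6) + 1 by ring, choose_two_succ]
      omega
  have := key n (by omega)
  omega

/-- One-step doubling: `min ((Nat.choose m 2 : ℝ) / Real.exp 1) ((2 : ℝ) ^ ((m - 12) / 2)) ≤ 2·min ((Nat.choose (m-1) 2 : ℝ) / Real.exp 1) ((2 : ℝ) ^ (((m-1) - 12) / 2))` for `m ≥ 13`. [folklore] -/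
private theorem sytBound_le_two_mul_pred {m : ℕ} (hm : 13 ≤ m) : min ((Nat.choose m 2 : ℝ) / Real.exp 1) ((2 : ℝ) ^ ((m - 12) / 2)) ≤ 2 * min ((Nat.choose (m - 1) 2 : ℝ) / Real.exp 1) ((2 : ℝ) ^ (((m - 1) - 12) / 2)) := by
  have he : 0 < Real.exp 1 := Real.exp_pos 1
  rw [mul_min_of_nonneg _ _ (by norm_num : (0 : ℝ) ≤ 2)]
  refine le_min (le_trans (min_le_left _ _) ?_) (le_trans (min_le_right _ _) ?_)
  · rw [mul_div_assoc', div_le_div_iff_of_pos_right he]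
    exact_mod_cast choose_two_le_two_mul_pred (by omega)
  · rw [← pow_succ']
    exact pow_le_pow_right₀ (by norm_num) (by omega)

/-- Two-step doubling: `min ((Nat.choose m 2 : ℝ) / Real.exp 1) ((2 : ℝ) ^ ((m - 12) / 2)) ≤ 2·min ((Nat.choose (m-2) 2 : ℝ) / Real.exp 1) ((2 : ℝ) ^ (((m-2) - 12) / 2))` for `m ≥ 13`. [folklore] -/
private theorem sytBound_le_two_mul_pred_pred {m : ℕ} (hm : 13 ≤ m) : min ((Nat.choose m 2 : ℝ) / Real.exp 1) ((2 : ℝ) ^ ((m - 12) / 2)) ≤ 2 * min ((Nat.choose (m - 2) 2 : ℝ) / Real.exp 1) ((2 : ℝ) ^ (((m - 2) - 12) / 2)) := by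
  have he : 0 < Real.exp 1 := Real.exp_pos 1
  rw [mul_min_of_nonneg _ _ (by norm_num : (0 : ℝ) ≤ 2)]
  refine le_min (le_trans (min_le_left _ _) ?_) (le_trans (min_le_right _ _) ?_)
  · rw [mul_div_assoc', div_le_div_iff_of_pos_right he]
    exact_mod_cast choose_two_le_two_mul_pred_pred (by omega)
  · rw [← pow_succ']
    exact pow_le_pow_right₀ (by norm_num) (by omega)

/-- For `m ≥ 40` the potential is the quadratic `C(m,2)/e`. [folklore] -/
private theorem sytBound_eq_of_le {m : ℕ} (hm : 40 ≤ m) : min ((Nat.choose m 2 : ℝ) / Real.exp 1) ((2 : ℝ) ^ ((m - 12) / 2)) = (m.choose 2 : ℝ) / Real.exp 1 := by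
  refine min_eq_left ?_
  -- `C(m,2) ≤ C(2k+13, 2) = (2k+13)(k+6) ≤ 2^k` with `k = ⌊(m-12)/2⌋ ≥ 14`
  have key : ∀ k, 14 ≤ k → (2 * k + 13) * (k + 6) ≤ 2 ^ k := by
    intro k hk
    induction k, hk using Nat.le_induction with
    | base => norm_num
    | succ k hk ih =>
      rw [pow_succ]
      nlinarith
  set k := (m - 12) / 2 with hk
  have hk14 : 14 ≤ k := by omega
  have hmk : m ≤ 2 * k + 13 := by omega
  have h1 : m.choose 2 ≤ (2 * k + 13).choose 2 := Nat.choose_le_choose 2 hmk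
  have h2 : (2 * k + 13).choose 2 = (2 * k + 13) * (k + 6) := by
    rw [Nat.choose_two_right]
    have : (2 * k + 13) * (2 * k + 13 - 1) = ((2 * k + 13) * (k + 6)) * 2 := by
      rw [show 2 * k + 13 - 1 = 2 * (k + 6) by omega]; ring
    rw [this, Nat.mul_div_cancel _ (by norm_num)]
  have h3 : (m.choose 2 : ℝ) ≤ 2 ^ k := by
    have := (h1.trans_eq h2).trans (key k hk14)
    exact_mod_cast this
  have he1 : 1 ≤ Real.exp 1 := Real.one_le_exp (by norm_num)
  calc (m.choose 2 : ℝ) / Real.exp 1 ≤ (m.choose 2 : ℝ) / 1 :=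
        div_le_div_of_nonneg_left (Nat.cast_nonneg _) one_pos he1
    _ = m.choose 2 := div_one _
    _ ≤ 2 ^ k := h3

/-! ## The induction -/

/-- Arithmetic of rectangles: `ab ≥ 13`, `a, b ≥ 2` force `a + 4 ≤ ab`. [folklore] -/
private theorem add_four_le_mul {a b : ℕ} (hb : 2 ≤ b) (hab : 13 ≤ a * b) : a + 4 ≤ a * b := by
  rcases (show b = 2 ∨ 3 ≤ b by omega) with rfl | hb3
  · omega
  · have := Nat.mul_le_mul_left a hb3
    omega

/-- Removing a corner from a diagram whose first row and first column both have at most `|Y| - 3`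
cells leaves a diagram whose first row and column have at most `|Y ⊖ c| - 2` cells. [folklore] -/
private theorem nonexc_removeAbove {Y : YoungDiagram} {r n : ℕ} (h : (Y.rowLen (r + 1) < Y.rowLen r))
    (hY : Y.cells.card = n + 1) (ha : Y.rowLen 0 + 3 ≤ n + 1) (hb : Y.colLen 0 + 3 ≤ n + 1) :
    (Y.removeAbove ((r, Y.rowLen r - 1))).cells.card = n ∧
      (Y.removeAbove ((r, Y.rowLen r - 1))).rowLen 0 + 2 ≤ n ∧
      (Y.removeAbove ((r, Y.rowLen r - 1))).colLen 0 + 2 ≤ n := by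
  refine ⟨card_removeAbove_cornerCell h hY, ?_, ?_⟩
  · have := rowLen_le_of_le (removeAbove_le Y ((r, Y.rowLen r - 1))) 0; omega
  · have := colLen_le_of_le (removeAbove_le Y ((r, Y.rowLen r - 1))) 0; omega

/-- **The lower bound on Young diagrams.** For every Young diagram `Y` with `|Y| = m` whose first row
and first column have at most `m - 2` cells, `min ((Nat.choose m 2 : ℝ) / Real.exp 1) ((2 : ℝ) ^ ((m - 12) / 2)) ≤ f^Y`. Strong induction on `m`:
`m ≤ 12` is free (`f ≥ 1`); a first row (or, transposing, first column) of exactly `m - 2` cells is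
the long-first-row bound; otherwise two corner rows give `2·sytBound(m-1)`, and a rectangle gives
`2·sytBound(m-2)` through its unique child. [folklore] -/
private theorem sytBound_le_syt : ∀ (m : ℕ) (Y : YoungDiagram), Y.cells.card = m →
    Y.rowLen 0 + 2 ≤ m → Y.colLen 0 + 2 ≤ m → min ((Nat.choose m 2 : ℝ) / Real.exp 1) ((2 : ℝ) ^ ((m - 12) / 2)) ≤ Nat.card (StdFilling Y.cells.card Y) := by
  intro m
  induction m using Nat.strong_induction_on with
  | _ m ih =>
    intro Y hY ha hb
    -- small sizes are free
    by_cases hm : m ≤ 12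
    · exact (sytBound_le_one hm).trans (by exact_mod_cast one_le_card_stdFilling Y)
    have hm13 : 13 ≤ m := by omega
    -- case A: first row of length `m - 2`
    by_cases hA : Y.rowLen 0 + 2 = m
    · refine (sytBound_le_choose m).trans ?_
      rw [← hY] at hA ⊢
      exact choose_div_exp_le_syt_of_rowLen (by omega) hA
    -- case B: first column of length `m - 2` (transpose)
    by_cases hB : Y.colLen 0 + 2 = m
    · refine (sytBound_le_choose m).trans ?_
      rw [← card_stdFilling_transpose']
      have hY' : Y.transpose.cells.card = m := by rw [YoungDiagram.card_transpose, hY]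
      have hA' : Y.transpose.rowLen 0 + 2 = Y.transpose.cells.card := by
        rw [YoungDiagram.rowLen_transpose, hY']; exact hB
      rw [← hY']
      exact choose_div_exp_le_syt_of_rowLen (by omega) hA'
    -- case C: both first row and first column have at most `m - 3` cells
    have ha3 : Y.rowLen 0 + 3 ≤ m := by omega
    have hb3 : Y.colLen 0 + 3 ≤ m := by omega
    obtain ⟨n, rfl⟩ : ∃ n, m = n + 1 := ⟨m - 1, by omega⟩
    have hcol : 1 ≤ Y.colLen 0 := one_le_colLen_of_card_pos (by omega)
    have hlast : (Y.rowLen (Y.colLen 0 - 1 + 1) < Y.rowLen (Y.colLen 0 - 1)) := isCornerRow_last hcol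
    by_cases hex : ∃ r, r + 1 < Y.colLen 0 ∧ (Y.rowLen (r + 1) < Y.rowLen r)
    · -- two distinct corner rows
      obtain ⟨r, hr, hcr⟩ := hex
      obtain ⟨c1, a1, b1⟩ := nonexc_removeAbove hcr hY ha3 hb3
      obtain ⟨c2, a2, b2⟩ := nonexc_removeAbove hlast hY ha3 hb3
      have i1 := ih n (by omega) _ c1 a1 b1
      have i2 := ih n (by omega) _ c2 a2 b2
      have hsum := add_le_syt_of_isCornerRow hcr hlast (by omega)
      have hsumR : (Nat.card (StdFilling (Y.removeAbove ((r, Y.rowLen r - 1))).cells.card (Y.removeAbove ((r, Y.rowLen r - 1)))) : ℝ) +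
          Nat.card (StdFilling (Y.removeAbove ((Y.colLen 0 - 1, Y.rowLen (Y.colLen 0 - 1) - 1))).cells.card (Y.removeAbove ((Y.colLen 0 - 1, Y.rowLen (Y.colLen 0 - 1) - 1)))) ≤ Nat.card (StdFilling Y.cells.card Y) := by exact_mod_cast hsum
      have hrec := sytBound_le_two_mul_pred hm13
      rw [Nat.add_sub_cancel] at hrec
      linarith
    · -- a rectangle `a × b`
      push Not at hex
      set a := Y.rowLen 0 with ha_def
      set b := Y.colLen 0 with hb_def
      have hrect : ∀ r, r < b → Y.rowLen r = a := fun r hr =>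
        rowLen_eq_rowLen_zero_of_no_corner (fun r hr => not_lt.2 (hex r hr)) hr
      have hab : n + 1 = a * b := hY ▸ card_eq_mul_of_rect hrect
      have ha2 : 2 ≤ a := by
        by_contra hlt
        have := card_eq_colLen_of_rowLen_le_one (Y := Y) (by omega)
        omega
      have hb2 : 2 ≤ b := by
        by_contra hlt
        have := card_eq_rowLen_of_colLen_le_one (Y := Y) (by omega)
        omega
      have ha4 : a + 4 ≤ n + 1 := hab ▸ add_four_le_mul hb2 (by omega)
      have hb4 : b + 4 ≤ n + 1 := by
        rw [hab, mul_comm]; exact add_four_le_mul ha2 (by rw [mul_comm]; omega)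
      -- the unique child `Z`
      set Z := Y.removeAbove ((b - 1, Y.rowLen (b - 1) - 1)) with hZ
      obtain ⟨m', rfl⟩ : ∃ m', n = m' + 1 := ⟨n - 1, by omega⟩
      have cZ : Z.cells.card = m' + 1 := card_removeAbove_cornerCell hlast hY
      have hZrow : ∀ r, r < b - 1 → Z.rowLen r = a := fun r hr => by
        rw [hZ, rowLen_removeAbove_cornerCell_of_ne hlast (by omega)]; exact hrect r (by omega)
      have hZlast : Z.rowLen (b - 1) = a - 1 := by
        rw [hZ, rowLen_removeAbove_cornerCell_self hlast, hrect (b - 1) (by omega)]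
      have hZb : Z.rowLen b = 0 := by
        rw [hZ, rowLen_removeAbove_cornerCell_of_ne hlast (by omega)]
        exact VershikKerov.rowLen_eq_zero _ le_rfl
      have hc1 : (Z.rowLen (b - 1 + 1) < Z.rowLen (b - 1)) := by
        rw [show b - 1 + 1 = b by omega, hZb, hZlast]; omega
      have hc2 : (Z.rowLen (b - 2 + 1) < Z.rowLen (b - 2)) := by
        rw [show b - 2 + 1 = b - 1 by omega, hZlast, hZrow (b - 2) (by omega)]
        omega
      have haZ : Z.rowLen 0 + 3 ≤ m' + 1 := by
        have := rowLen_le_of_le (removeAbove_le Y ((b - 1, Y.rowLen (b - 1) - 1))) 0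
        rw [← hZ] at this; omega
      have hbZ : Z.colLen 0 + 3 ≤ m' + 1 := by
        have := colLen_le_of_le (removeAbove_le Y ((b - 1, Y.rowLen (b - 1) - 1))) 0
        rw [← hZ] at this; omega
      obtain ⟨c1, a1, b1⟩ := nonexc_removeAbove hc1 cZ haZ hbZ
      obtain ⟨c2, a2, b2⟩ := nonexc_removeAbove hc2 cZ haZ hbZ
      have i1 := ih m' (by omega) _ c1 a1 b1
      have i2 := ih m' (by omega) _ c2 a2 b2
      have hsum := add_le_syt_of_isCornerRow hc1 hc2 (by omega)
      have hsumR : (Nat.card (StdFilling (Z.removeAbove ((b - 1, Z.rowLen (b - 1) - 1))).cells.card (Z.removeAbove ((b - 1, Z.rowLen (b - 1) - 1)))) : ℝ) +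
          Nat.card (StdFilling (Z.removeAbove ((b - 2, Z.rowLen (b - 2) - 1))).cells.card (Z.removeAbove ((b - 2, Z.rowLen (b - 2) - 1)))) ≤ Nat.card (StdFilling Z.cells.card Z) := by exact_mod_cast hsum
      have hZY : (Nat.card (StdFilling Z.cells.card Z) : ℝ) ≤ Nat.card (StdFilling Y.cells.card Y) := by exact_mod_cast le_syt_of_isCornerRow hlast
      have hrec := sytBound_le_two_mul_pred_pred hm13
      rw [show m' + 1 + 1 - 2 = m' by omega] at hrec
      linarith

/-! ## The bound for partitions -/

/-- The first row of the diagram of `μ` is a part of `μ` (or the diagram is empty). [folklore] -/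
private theorem rowLen_zero_mem_parts_or {d : ℕ} (μ : Nat.Partition d) :
    μ.youngDiagram.rowLen 0 ∈ μ.parts ∨ μ.youngDiagram.rowLen 0 = 0 := by
  rcases Nat.eq_zero_or_pos (μ.youngDiagram.colLen 0) with h | h
  · exact Or.inr (VershikKerov.rowLen_eq_zero _ (by omega))
  · left
    have h1 : μ.youngDiagram.rowLens.head? = some (μ.youngDiagram.rowLen 0) := head?_rowLens h
    rw [μ.rowLens_youngDiagram] at h1
    have h2 : μ.youngDiagram.rowLen 0 ∈ μ.sortedParts := List.mem_of_mem_head? h1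
    exact (Multiset.mem_sort _).1 h2

/-- The first column of the diagram of `μ` has `μ.parts.card` cells. [folklore] -/
private theorem colLen_zero_youngDiagram {d : ℕ} (μ : Nat.Partition d) :
    μ.youngDiagram.colLen 0 = μ.parts.card := by
  rw [← YoungDiagram.length_rowLens, μ.rowLens_youngDiagram, μ.length_sortedParts]

/-- **Quadratic lower bound for Specht dimensions (weak Rasala).** For `n ≥ 40` and a partition
`μ ⊢ n` all of whose parts are at most `n - 2` and which has at most `n - 2` parts — i.e. `μ` is none of
`(n)`, `(n-1,1)`, `(1ⁿ)`, `(2,1^{n-2})` — the number of standard Young tableaux satisfies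
`C(n,2)/e ≤ f^μ`. (Rasala 1977 gives the sharp minimum `n(n-3)/2` for `n ≥ 9`.) [folklore] -/
private theorem choose_div_exp_le_numStandardTableaux {n : ℕ} (hn : 40 ≤ n) (μ : Nat.Partition n)
    (hrow : ∀ a ∈ μ.parts, a + 2 ≤ n) (hcol : μ.parts.card + 2 ≤ n) :
    (n.choose 2 : ℝ) / Real.exp 1 ≤ numStandardTableaux μ := by
  rw [numStandardTableaux_eq_card_stdFilling', ← sytBound_eq_of_le hn]
  refine sytBound_le_syt n μ.youngDiagram μ.card_cells_youngDiagram ?_ ?_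
  · rcases rowLen_zero_mem_parts_or μ with h | h
    · exact hrow _ h
    · omega
  · rw [colLen_zero_youngDiagram]; exact hcol

/-- **Quadratic lower bound for Specht dimensions, integer form**: under the same hypotheses,
`n(n-1) ≤ 6 f^μ`. [folklore] -/
private theorem quadratic_le_numStandardTableaux {n : ℕ} (hn : 40 ≤ n) (μ : Nat.Partition n)
    (hrow : ∀ a ∈ μ.parts, a + 2 ≤ n) (hcol : μ.parts.card + 2 ≤ n) :
    n * (n - 1) ≤ 6 * numStandardTableaux μ := by
  have h := choose_div_exp_le_numStandardTableaux hn μ hrow hcol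
  rw [div_le_iff₀ (Real.exp_pos 1)] at h
  have he : Real.exp 1 < 3 := lt_trans Real.exp_one_lt_d9 (by norm_num)
  have hf : (0 : ℝ) ≤ numStandardTableaux μ := Nat.cast_nonneg _
  have h2 : (n.choose 2 : ℝ) * 2 = n * (n - 1 : ℕ) := by
    have := Nat.choose_two_right n
    have hdvd : 2 ∣ n * (n - 1) := (Nat.even_mul_pred_self n).two_dvd
    have e : n.choose 2 * 2 = n * (n - 1) := by rw [this, Nat.div_mul_cancel hdvd]
    exact_mod_cast e
  have h3 : ((n * (n - 1) : ℕ) : ℝ) ≤ 6 * numStandardTableaux μ := by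
    push_cast
    rw [← h2]
    nlinarith [mul_nonneg hf (show (0 : ℝ) ≤ 3 - Real.exp 1 by linarith)]
  exact_mod_cast h3

end Literature.RepresentationTheory.FiniteGroups.SpechtPolynomialSlack

end Part2

/-!
## Part 3 — port of `Summits/ValiantsHypothesis/ValiantsHypothesis/Theorems/SymPencilEquivariantSdcNotQPYoungDegreeBoundPrelim.lean`

# ValiantsHypothesis / SymPencil — crux `EquivariantSdcNotQP` (stmt-ValiantsHypothesis-17792), line
# `birth_EquivariantSdcNotQP`, stub `stub_permify`, the Young-tableaux degree inequality (YD): step 1 —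
# TOOLS (monotonicity of `f^λ`, transposition, long first rows, the index of a Young subgroup)

Preliminaries for the proof of (YD) «`∃ c, ∀ λ ⊢ n, ∃ ν ∈ {λ, λᵗ}, [𝔖_n : R_ν] ≤ 2^{(log₂ f^λ + log₂ n + c)^c}`»
(hypothesis `hYD` of `youngFixedVector_of_degreeBound`), on the tree's tableaux layer
(`PartitionTableaux`, `StandardFillings`, `PartitionTableauxProofs`, `FirstRowPeeling`).  Helper of the
item (`--supports stmt-ValiantsHypothesis-17792 --as helper`); 0 definitions, 0 named facts:
* `card_stdFilling_mono`, `numStandardTableaux_mono` — **monotonicity `f^μ ≤ f^λ` for `μ ⊆ λ`** (from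
  the branching rule `StdFilling.card_stdFilling_succ`: removing a maximal cell outside `μ` is a corner
  removal, whose term appears in the branching sum);
* `numStandardTableaux_transpose` — `f^{λᵗ} = f^λ` (through `dim S^λ = f^λ` and `S^{λᵗ} ≅ S^λ ⊗ sgn`);
* `choose_le_three_mul_numStandardTableaux` — `C(n, j) ≤ 3 f^{(a,ν)}` for a long first row `a ≥ 2j`
  (`FirstRowPeeling.choose_mul_numStandardTableaux_le_exp_mul`, `e < 3`, `f^ν ≥ 1`);
* `two_pow_le_choose` — `2^j ≤ C(n, j)` for `n ≥ 3j`;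
* `index_rowStabilizer_mul_factorial_le` — `[𝔖_n : R_λ] · λ₁! ≤ n!` (the permutations of the first
  row lie in the Young subgroup `R_λ`).

Honest framing: tableaux combinatorics; (YD), (H1), `stub_permify`, the crux and `VP ≠ VNP` remain OPEN
here.
-/

section Part3


namespace Literature.RepresentationTheory.FiniteGroups.YoungBounds

open Literature.NumberTheory.DiophantineGeometry

/-! ### Monotonicity of `f^λ` under inclusion of diagrams -/

/-- One branching term: for a cell `c` of `Y` (`|Y| = m + 1`), `#Std_m(Y ⊖ c) ≤ #Std_{m+1}(Y)`.
[folklore] -/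
private theorem card_stdFilling_removeAbove_le (Y : YoungDiagram) (m : ℕ) {c : ℕ × ℕ} (hc : c ∈ Y.cells) :
    Nat.card (StdFilling m (Y.removeAbove c)) ≤ Nat.card (StdFilling (m + 1) Y) := by
  rw [StdFilling.card_stdFilling_succ]
  exact Finset.single_le_sum (f := fun c => Nat.card (StdFilling m (Y.removeAbove c)))
    (fun _ _ => Nat.zero_le _) hc

/-- **Monotonicity of the number of standard Young tableaux**: if the diagram `Y'` is contained in
`Y`, then `#SYT(Y') ≤ #SYT(Y)` (remove from `Y` a maximal cell outside `Y'` — a corner — and use the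
branching rule). [folklore] -/
private theorem card_stdFilling_mono :
    ∀ (d : ℕ) (Y' Y : YoungDiagram), Y'.cells ⊆ Y.cells → Y.cells.card = Y'.cells.card + d →
      Nat.card (StdFilling Y'.cells.card Y') ≤ Nat.card (StdFilling Y.cells.card Y) := by
  intro d
  induction d with
  | zero =>
    intro Y' Y hsub hcard
    have heq : Y'.cells = Y.cells := Finset.eq_of_subset_of_card_le hsub (by omega)
    have hYY : Y' = Y := YoungDiagram.ext heq
    subst hYY
    exact le_rfl
  | succ d ih =>
    intro Y' Y hsub hcard
    have hne : (Y.cells \ Y'.cells).Nonempty := by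
      rw [← Finset.card_pos, Finset.card_sdiff_of_subset hsub]
      omega
    obtain ⟨c, hc, hmax⟩ := Finset.exists_max_image (Y.cells \ Y'.cells)
      (fun x : ℕ × ℕ => x.1 + x.2) hne
    have hcY : c ∈ Y.cells := (Finset.mem_sdiff.1 hc).1
    have hcY' : c ∉ Y'.cells := (Finset.mem_sdiff.1 hc).2
    -- `c` is maximal in `Y` for the product order
    have hcmax : ∀ x ∈ Y.cells, c ≤ x → x = c := by
      intro x hx hcx
      have hxY' : x ∉ Y'.cells := fun hxY' => hcY' (Y'.isLowerSet hcx hxY')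
      have hle := hmax x (Finset.mem_sdiff.2 ⟨hx, hxY'⟩)
      obtain ⟨h1, h2⟩ := Prod.mk_le_mk.1 (show (c.1, c.2) ≤ (x.1, x.2) from hcx)
      exact Prod.ext (by omega) (by omega)
    set Y₁ := Y.removeAbove c with hY₁
    have hY₁cells : Y₁.cells = Y.cells.erase c := by
      ext x
      rw [hY₁, YoungDiagram.removeAbove_cells, Finset.mem_filter, Finset.mem_erase]
      constructor
      · rintro ⟨hx, hcx⟩
        exact ⟨fun h => hcx (h ▸ le_rfl), hx⟩
      · rintro ⟨hxc, hx⟩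
        exact ⟨hx, fun hcx => hxc (hcmax x hx hcx)⟩
    have hsub₁ : Y'.cells ⊆ Y₁.cells := by
      intro x hx
      rw [hY₁cells, Finset.mem_erase]
      exact ⟨fun h => hcY' (h ▸ hx), hsub hx⟩
    have hcard₁ : Y₁.cells.card = Y'.cells.card + d := by
      rw [hY₁cells, Finset.card_erase_of_mem hcY]
      omega
    have hYc : Y.cells.card = Y₁.cells.card + 1 := by omega
    calc Nat.card (StdFilling Y'.cells.card Y') ≤ Nat.card (StdFilling Y₁.cells.card Y₁) :=
          ih Y' Y₁ hsub₁ hcard₁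
      _ ≤ Nat.card (StdFilling Y.cells.card Y) := by
          rw [hYc]
          exact card_stdFilling_removeAbove_le Y _ hcY

/-- **`f^μ ≤ f^λ` for partitions `μ ⊢ m`, `λ ⊢ n` with `μ ⊆ λ`** (Young diagrams). [folklore] -/
private theorem numStandardTableaux_mono {m n : ℕ} (μ : Nat.Partition m) (lam : Nat.Partition n)
    (h : μ.youngDiagram.cells ⊆ lam.youngDiagram.cells) :
    numStandardTableaux μ ≤ numStandardTableaux lam := by
  rw [numStandardTableaux_eq_card_stdFilling, numStandardTableaux_eq_card_stdFilling]
  have hm := μ.card_cells_youngDiagram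
  have hn := lam.card_cells_youngDiagram
  have hmn : m ≤ n := by
    rw [← hm, ← hn]
    exact Finset.card_le_card h
  have key := card_stdFilling_mono (n - m) μ.youngDiagram lam.youngDiagram h (by rw [hm, hn]; omega)
  rwa [hm, hn] at key

/-! ### Transposition -/

/-- **`f^{λᵗ} = f^λ`** (`dim S^{λᵗ} = dim S^λ` through `S^{λᵗ} ≅ S^λ ⊗ sgn` and `dim S^μ = f^μ`).
[folklore] -/
private theorem numStandardTableaux_transpose {n : ℕ} (lam : Nat.Partition n) :
    numStandardTableaux lam.transpose = numStandardTableaux lam := by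
  rw [← finrank_spechtIdeal_holds (k := ℂ) lam.transpose, ← finrank_spechtIdeal_holds (k := ℂ) lam]
  exact (spechtIdealTransposeEquiv ℂ lam).finrank_eq.symm

/-! ### Long first rows -/

/-- **`C(n, j) ≤ 3 f^{(a,ν)}` when `a ≥ 2j`** (`μ = (a, ν) ⊢ n`, `ν ⊢ j`): the tree's
`C(n,j) f^ν ≤ e f^μ` with `f^ν ≥ 1` and `e < 3`. [folklore] -/
private theorem choose_le_three_mul_numStandardTableaux {n j a : ℕ} {μ : Nat.Partition n} {ν : Nat.Partition j}
    (hs : μ.sortedParts = a :: ν.sortedParts) (hja : 2 * j ≤ a) :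
    n.choose j ≤ 3 * numStandardTableaux μ := by
  have h := choose_mul_numStandardTableaux_le_exp_mul hs hja
  have hν : 1 ≤ numStandardTableaux ν := numStandardTableaux_pos_holds ν
  have he : Real.exp 1 ≤ 3 := le_trans Real.exp_one_lt_d9.le (by norm_num)
  have h2 : (n.choose j : ℝ) ≤ 3 * numStandardTableaux μ := by
    calc (n.choose j : ℝ) ≤ n.choose j * numStandardTableaux ν :=
          le_mul_of_one_le_right (by positivity) (by exact_mod_cast hν)
      _ ≤ Real.exp 1 * numStandardTableaux μ := h
      _ ≤ 3 * numStandardTableaux μ := mul_le_mul_of_nonneg_right he (by positivity)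
  exact_mod_cast h2

/-- `2^j ≤ C(n, j)` when `n ≥ 3j`. [folklore] -/
private theorem two_pow_le_choose {n j : ℕ} (hn : 3 * j ≤ n) : 2 ^ j ≤ n.choose j := by
  have key : ∀ k, k ≤ j → 2 ^ k ≤ n.choose k := by
    intro k
    induction k with
    | zero => intro _; simp
    | succ k ih =>
      intro hk
      have h1 := ih (by omega)
      have h2 : n.choose (k + 1) * (k + 1) = n.choose k * (n - k) := Nat.choose_succ_right_eq n k
      have h3 : 2 * (k + 1) ≤ n - k := by omega
      have h4 : n.choose k * (2 * (k + 1)) ≤ n.choose (k + 1) * (k + 1) := by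
        rw [h2]; exact Nat.mul_le_mul_left _ h3
      have h5 : 2 * n.choose k ≤ n.choose (k + 1) := by
        have : 2 * n.choose k * (k + 1) ≤ n.choose (k + 1) * (k + 1) := by
          calc 2 * n.choose k * (k + 1) = n.choose k * (2 * (k + 1)) := by ring
            _ ≤ _ := h4
        exact Nat.le_of_mul_le_mul_right this (Nat.succ_pos k)
      calc 2 ^ (k + 1) = 2 * 2 ^ k := by ring
        _ ≤ 2 * n.choose k := Nat.mul_le_mul_left _ h1
        _ ≤ n.choose (k + 1) := h5
  exact key j le_rfl

/-! ### The index of a Young subgroup -/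

/-- Row `0` of the canonical tableau of `μ = (a, …)` consists of the entries `< a`. [folklore] -/
private theorem rowOf_eq_zero_iff {n a : ℕ} (μ : Nat.Partition n) {l : List ℕ} (hs : μ.sortedParts = a :: l)
    (i : Fin n) : μ.rowOf i = 0 ↔ (i : ℕ) < a := by
  have h0 : 0 < μ.sortedParts.length := by rw [hs]; simp
  have h := μ.sum_take_succ_le_iff_lt_rowOf i h0
  rw [hs] at h
  simp only [zero_add, List.take_succ_cons, List.take_zero, List.sum_cons, List.sum_nil, add_zero] at h
  constructor
  · intro h0
    by_contra hlt
    rw [not_lt] at hlt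
    have := h.1 hlt
    omega
  · intro hlt
    by_contra h0
    have := h.2 (Nat.pos_of_ne_zero h0)
    omega

/-- **`[𝔖_n : R_μ] · a! ≤ n!`** for `μ = (a, …)`: the permutations of the first row form a subgroup
of order `a!` of the Young subgroup `R_μ`. [folklore] -/
private theorem index_rowStabilizer_mul_factorial_le {n a : ℕ} (μ : Nat.Partition n) {l : List ℕ}
    (hs : μ.sortedParts = a :: l) :
    (rowStabilizer μ).index * a.factorial ≤ n.factorial := by
  classical
  have ha : a ≤ n := by
    have := μ.sum_sortedParts
    rw [hs, List.sum_cons] at this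
    omega
  -- the permutations of `{i : i < a}`
  set P : Subgroup (Equiv.Perm (Fin n)) :=
    (Equiv.Perm.ofSubtype : Equiv.Perm {i : Fin n // (i : ℕ) < a} →* Equiv.Perm (Fin n)).range
    with hP
  have hPle : P ≤ rowStabilizer μ := by
    rintro _ ⟨τ, rfl⟩
    rw [mem_rowStabilizer_iff]
    intro i
    by_cases hi : (i : ℕ) < a
    · have h1 : ((Equiv.Perm.ofSubtype τ) i : ℕ) < a := by
        rw [Equiv.Perm.ofSubtype_apply_of_mem τ hi]
        exact (τ ⟨i, hi⟩).2
      rw [(rowOf_eq_zero_iff μ hs _).2 h1, (rowOf_eq_zero_iff μ hs _).2 hi]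
    · rw [Equiv.Perm.ofSubtype_apply_of_not_mem τ hi]
  have hPcard : Nat.card P = a.factorial := by
    rw [hP, ← SetLike.coe_sort_coe, MonoidHom.coe_range,
      Nat.card_range_of_injective Equiv.Perm.ofSubtype_injective,
      Nat.card_perm, Nat.card_eq_fintype_card, Fintype.card_fin_lt_of_le ha]
  have hidx : (rowStabilizer μ).index ≤ P.index :=
    Nat.le_of_dvd (Nat.pos_of_ne_zero Subgroup.index_ne_zero_of_finite) (Subgroup.index_dvd_of_le hPle)
  have hPidx : P.index * a.factorial = n.factorial := by
    rw [← hPcard, Subgroup.index_mul_card, Nat.card_perm, Nat.card_eq_fintype_card, Fintype.card_fin]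
  calc (rowStabilizer μ).index * a.factorial ≤ P.index * a.factorial := Nat.mul_le_mul_right _ hidx
    _ = n.factorial := hPidx

end Literature.RepresentationTheory.FiniteGroups.YoungBounds

end Part3

/-!
## Part 4 — port of `Summits/ValiantsHypothesis/ValiantsHypothesis/Theorems/MonotoneRestorationMixingScaleSpechtDimLinear.lean`

# The linear lower bound for Specht dimensions: `f^λ ≥ n - 1` off the one-row and one-column shapes

Helper file (1/3) of the discharge of the named fact
`Literature.RepresentationTheory.FiniteGroups.JamesKerber1981_thm_2_5_15` (minimal degree `n - 1` of the
alternating group), filed for route MonotoneRestoration, crux `OrbitRestorationQP`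
(stmt-ValiantsHypothesis-18293), line `mixing-scale`: its registered input `alternatingProductMixing`
(Babai–Nikolov–Pyber product mixing in `𝔄_n`) is reduced in the tree to that fact
(`Literature.GroupTheory.QuasirandomGroups.alternatingProductMixing_of_minDegree`).

Main result, on Young diagrams (`f^Y = #` standard fillings of `Y`, the tree's `StdFilling`):

* `linear_le_syt` — **for every Young diagram `Y` with `|Y| ≥ 5` cells which is neither a single row
  nor a single column, `|Y| - 1 ≤ f^Y`** (sharp at `(n-1,1)`, `(2,1^{n-2})`, `(3,3)`, `(2,2,2)`);
* `sub_one_le_numStandardTableaux` — the same for partitions `μ ⊢ n`.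

This is the combinatorial half of the classical fact that the minimal degree of a faithful complex
character of `𝔖_n` (`n ≥ 5`) is `n - 1` (James–Kerber 2.4.10; Rasala 1977); the tree's
`…PolynomialSlackMinDegree` had only `⌊n/4⌋`.  Proof: strong induction on `|Y|` over diagrams, by the
branching inequalities of `…PolynomialSlackSpechtBranching` (`f^{Y ⊖ c} + f^{Y ⊖ c'} ≤ f^Y` for two corner
rows): a first row (or, transposing, first column) of exactly `|Y| - 1` cells is the hook `(m-1,1)`,
handled by its two corners; otherwise two corner rows give `2(m-2) ≥ m-1`, and a rectangle `a × b` is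
bounded through the two corners of its unique child (`(a^{b-1}, a-1)`), with the single exceptional value
`f^{(2,2)} = 2` carried along as a correction term (`… + if m = 4 ∧ rowLen 0 = 2 then 1 else 0`).

References: G. James, A. Kerber, *The Representation Theory of the Symmetric Group* (1981), 2.4.10;
R. Rasala, *On the minimal degrees of characters of `S_n`*, J. Algebra 45 (1977); G. James, LNM 682, §9.
Honest framing: pure combinatorics; nothing here bears on `VP ≠ VNP`.
-/

section Part4

namespace Literature.RepresentationTheory.FiniteGroups.SpechtDim

open Literature.NumberTheory.DiophantineGeometry Literature.RepresentationTheory.FiniteGroups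
open Literature.RepresentationTheory.FiniteGroups.SpechtPolynomialSlack

/-! ## Diagram bookkeeping -/

/-- A diagram sits inside the box `colLen 0 × rowLen 0`, so `|Y| ≤ rowLen 0 · colLen 0`. [folklore] -/
private theorem card_le_rowLen_mul_colLen (Y : YoungDiagram) : Y.cells.card ≤ Y.rowLen 0 * Y.colLen 0 := by
  have hsub : Y.cells ⊆ (Finset.range (Y.colLen 0)) ×ˢ (Finset.range (Y.rowLen 0)) := by
    rintro ⟨i, j⟩ hc
    have hc' : (i, j) ∈ Y := (YoungDiagram.mem_cells _).1 hc
    rw [Finset.mem_product, Finset.mem_range, Finset.mem_range]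
    exact ⟨lt_of_lt_of_le (YoungDiagram.mem_iff_lt_colLen.1 hc') (Y.colLen_anti 0 j (Nat.zero_le _)),
      lt_of_lt_of_le (YoungDiagram.mem_iff_lt_rowLen.1 hc') (Y.rowLen_anti 0 i (Nat.zero_le _))⟩
  calc Y.cells.card ≤ ((Finset.range (Y.colLen 0)) ×ˢ (Finset.range (Y.rowLen 0))).card :=
        Finset.card_le_card hsub
    _ = Y.rowLen 0 * Y.colLen 0 := by
        rw [Finset.card_product, Finset.card_range, Finset.card_range, mul_comm]

/-- In a rectangle with `b = colLen 0` rows of length `a`, every column `j < a` has length `b`.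
[folklore] -/
private theorem colLen_eq_of_rect {Y : YoungDiagram} {a b : ℕ} (hrows : ∀ r, r < b → Y.rowLen r = a)
    (hcol : Y.colLen 0 = b) {j : ℕ} (hj : j < a) : Y.colLen j = b := by
  refine YoungDiagram.colLen_eq_of_forall_mem_iff fun i => ?_
  rw [YoungDiagram.mem_iff_lt_rowLen]
  constructor
  · intro h
    by_contra hib
    rw [VershikKerov.rowLen_eq_zero Y (by rw [hcol]; omega)] at h
    exact absurd h (Nat.not_lt_zero _)
  · intro hib
    rw [hrows i hib]
    exact hj

/-- Removing a corner from a diagram whose first row and first column have at most `|Y| - 2` cells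
leaves a diagram that is neither a row nor a column. [folklore] -/
private theorem removeAbove_not_line {Y : YoungDiagram} {r n : ℕ} (h : Y.rowLen (r + 1) < Y.rowLen r)
    (hY : Y.cells.card = n + 1) (ha : Y.rowLen 0 + 2 ≤ n + 1) (hb : Y.colLen 0 + 2 ≤ n + 1) :
    (Y.removeAbove (r, Y.rowLen r - 1)).cells.card = n ∧
      (Y.removeAbove (r, Y.rowLen r - 1)).rowLen 0 + 1 ≤ n ∧
      (Y.removeAbove (r, Y.rowLen r - 1)).colLen 0 + 1 ≤ n := by
  refine ⟨card_removeAbove_cornerCell h hY, ?_, ?_⟩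
  · have := rowLen_le_of_le (removeAbove_le Y (r, Y.rowLen r - 1)) 0; omega
  · have := colLen_le_of_le (removeAbove_le Y (r, Y.rowLen r - 1)) 0; omega

/-! ## The induction -/

/-- **The hook `(m-1, 1)`.**  If the first row of `Y` has exactly `|Y| - 1 = m - 1` cells and `Y` is not
a row, then `Y = (m-1, 1)` and `m - 1 ≤ f^Y`, granted the bound for the smaller hook `(m-2, 1)`
(induction hypothesis `ih`, with its correction term). [folklore] -/
private theorem hook_two_rows_bound (m : ℕ)
    (ih : ∀ m' < m, ∀ Y' : YoungDiagram, Y'.cells.card = m' → Y'.rowLen 0 + 1 ≤ m' →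
      Y'.colLen 0 + 1 ≤ m' → m' ≤ Nat.card (StdFilling Y'.cells.card Y') + 1 +
        (if m' = 4 ∧ Y'.rowLen 0 = 2 then 1 else 0))
    (Y : YoungDiagram) (hY : Y.cells.card = m) (hrow : Y.rowLen 0 + 1 = m) (hcol : Y.colLen 0 + 1 ≤ m) :
    m ≤ Nat.card (StdFilling Y.cells.card Y) + 1 := by
  -- `Y` has exactly two rows, of lengths `m - 1` and `1`
  have hc2 : 2 ≤ Y.colLen 0 := by
    by_contra hlt
    have := card_eq_rowLen_of_colLen_le_one (Y := Y) (by omega)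
    omega
  obtain ⟨k, hk⟩ : ∃ k, Y.colLen 0 = k + 1 := ⟨Y.colLen 0 - 1, by omega⟩
  have hsum := card_eq_sum_rowLen Y
  rw [hY, hk, Finset.sum_range_succ'] at hsum
  have hterms : ∀ r ∈ Finset.range k, 1 ≤ Y.rowLen (r + 1) := fun r hr =>
    one_le_rowLen_of_lt_colLen (by rw [hk]; have := Finset.mem_range.1 hr; omega)
  have hksum : (Finset.range k).card • 1 ≤ ∑ r ∈ Finset.range k, Y.rowLen (r + 1) :=
    Finset.card_nsmul_le_sum _ _ 1 hterms
  rw [Finset.card_range, smul_eq_mul, mul_one] at hksum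
  have hk1 : k = 1 := by omega
  subst hk1
  have hr1 : Y.rowLen 1 = 1 := by
    simp only [Finset.sum_range_one, zero_add] at hsum
    omega
  have hr2 : Y.rowLen 2 = 0 := VershikKerov.rowLen_eq_zero Y (by omega)
  have hm3 : 3 ≤ m := by omega
  -- the two corner rows `0` and `1`
  have h0 : Y.rowLen (0 + 1) < Y.rowLen 0 := by rw [hr1]; omega
  have h1 : Y.rowLen (1 + 1) < Y.rowLen 1 := by rw [hr2, hr1]; omega
  have hbr := add_le_syt_of_isCornerRow h0 h1 (by omega)
  have hone := one_le_card_stdFilling (Y.removeAbove (1, Y.rowLen 1 - 1))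
  obtain ⟨n, rfl⟩ : ∃ n, m = n + 1 := ⟨m - 1, by omega⟩
  have hc0 : (Y.removeAbove (0, Y.rowLen 0 - 1)).cells.card = n := card_removeAbove_cornerCell h0 hY
  have hr0' : (Y.removeAbove (0, Y.rowLen 0 - 1)).rowLen 0 = n - 1 := by
    rw [rowLen_removeAbove_cornerCell_self h0]; omega
  have hcol' : (Y.removeAbove (0, Y.rowLen 0 - 1)).colLen 0 ≤ 2 := by
    have := colLen_le_of_le (removeAbove_le Y (0, Y.rowLen 0 - 1)) 0; omega
  -- `m = 3`: both children contribute `1`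
  by_cases hn2 : n = 2
  · subst hn2
    have := one_le_card_stdFilling (Y.removeAbove (0, Y.rowLen 0 - 1))
    omega
  -- `m ≥ 4`: the child `(m-2, 1)` is neither a row nor a column
  have i0 := ih n (by omega) _ hc0 (by omega) (by omega)
  rw [if_neg (by omega)] at i0
  omega

/-- **A rectangle `a × b` with `a ≥ 3`, `b ≥ 2`.**  Then `ab - 1 ≤ f^Y`, granted the bound for the two
corners of the unique child `(a^{b-1}, a-1)` (induction hypothesis `ih`). [folklore] -/
private theorem rect_bound (m : ℕ)
    (ih : ∀ m' < m, ∀ Y' : YoungDiagram, Y'.cells.card = m' → Y'.rowLen 0 + 1 ≤ m' →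
      Y'.colLen 0 + 1 ≤ m' → m' ≤ Nat.card (StdFilling Y'.cells.card Y') + 1 +
        (if m' = 4 ∧ Y'.rowLen 0 = 2 then 1 else 0))
    (Y : YoungDiagram) {a b : ℕ} (hY : Y.cells.card = m) (hm : m = a * b) (ha : 3 ≤ a) (hb : 2 ≤ b)
    (hrows : ∀ r, r < b → Y.rowLen r = a) (hcolY : Y.colLen 0 = b) :
    m ≤ Nat.card (StdFilling Y.cells.card Y) + 1 := by
  have hab2 : a * 2 ≤ a * b := Nat.mul_le_mul_left a hb
  have hab3 : 3 * b ≤ a * b := Nat.mul_le_mul_right b ha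
  have hm6 : 6 ≤ m := by omega
  obtain ⟨n, rfl⟩ : ∃ n, m = n + 1 := ⟨m - 1, by omega⟩
  obtain ⟨k, rfl⟩ : ∃ k, n = k + 1 := ⟨n - 1, by omega⟩
  have hrowb : Y.rowLen b = 0 := VershikKerov.rowLen_eq_zero Y (by rw [hcolY])
  have hlast : Y.rowLen (b - 1 + 1) < Y.rowLen (b - 1) := by
    rw [show b - 1 + 1 = b by omega, hrowb, hrows (b - 1) (by omega)]; omega
  -- the unique child `Z = (a^{b-1}, a-1)`
  set Z := Y.removeAbove (b - 1, Y.rowLen (b - 1) - 1) with hZ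
  have cZ : Z.cells.card = k + 1 := card_removeAbove_cornerCell hlast hY
  have hZrow : ∀ r, r < b - 1 → Z.rowLen r = a := fun r hr => by
    rw [hZ, rowLen_removeAbove_cornerCell_of_ne hlast (by omega)]; exact hrows r (by omega)
  have hZlast : Z.rowLen (b - 1) = a - 1 := by
    rw [hZ, rowLen_removeAbove_cornerCell_self hlast, hrows (b - 1) (by omega)]
  have hZb : Z.rowLen b = 0 := by
    rw [hZ, rowLen_removeAbove_cornerCell_of_ne hlast (by omega)]; exact hrowb
  have hc1 : Z.rowLen (b - 1 + 1) < Z.rowLen (b - 1) := by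
    rw [show b - 1 + 1 = b by omega, hZb, hZlast]; omega
  have hc2 : Z.rowLen (b - 2 + 1) < Z.rowLen (b - 2) := by
    rw [show b - 2 + 1 = b - 1 by omega, hZlast, hZrow (b - 2) (by omega)]; omega
  have hZY : Nat.card (StdFilling Z.cells.card Z) ≤ Nat.card (StdFilling Y.cells.card Y) :=
    le_syt_of_isCornerRow hlast
  have hsum := add_le_syt_of_isCornerRow hc1 hc2 (by omega)
  -- the two grandchildren
  have c1 : (Z.removeAbove (b - 1, Z.rowLen (b - 1) - 1)).cells.card = k := card_removeAbove_cornerCell hc1 cZ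
  have c2 : (Z.removeAbove (b - 2, Z.rowLen (b - 2) - 1)).cells.card = k := card_removeAbove_cornerCell hc2 cZ
  have hcolZ : Z.colLen 0 ≤ b := by
    have := colLen_le_of_le (removeAbove_le Y (b - 1, Y.rowLen (b - 1) - 1)) 0
    rw [← hZ] at this; omega
  have b1 : (Z.removeAbove (b - 1, Z.rowLen (b - 1) - 1)).colLen 0 ≤ b :=
    (colLen_le_of_le (removeAbove_le Z _) 0).trans hcolZ
  have b2 : (Z.removeAbove (b - 2, Z.rowLen (b - 2) - 1)).colLen 0 ≤ b :=
    (colLen_le_of_le (removeAbove_le Z _) 0).trans hcolZ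
  have a1 : (Z.removeAbove (b - 1, Z.rowLen (b - 1) - 1)).rowLen 0 = a := by
    rw [rowLen_removeAbove_cornerCell_of_ne hc1 (by omega)]; exact hZrow 0 (by omega)
  have i1 := ih k (by omega) _ c1 (by omega) (by omega)
  rw [if_neg (by omega)] at i1
  by_cases hb2 : b = 2
  · subst hb2
    have a2 : (Z.removeAbove (2 - 2, Z.rowLen (2 - 2) - 1)).rowLen 0 = a - 1 := by
      rw [show (2 : ℕ) - 2 = 0 from rfl, rowLen_removeAbove_cornerCell_self (r := 0) (by simpa using hc2),
        hZrow 0 (by omega)]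
    have i2 := ih k (by omega) _ c2 (by omega) (by omega)
    split_ifs at i2 with hδ
    · omega
    · omega
  · have a2 : (Z.removeAbove (b - 2, Z.rowLen (b - 2) - 1)).rowLen 0 = a := by
      rw [rowLen_removeAbove_cornerCell_of_ne hc2 (by omega)]; exact hZrow 0 (by omega)
    have i2 := ih k (by omega) _ c2 (by omega) (by omega)
    rw [if_neg (by omega)] at i2
    omega

/-- **The induction.**  For every Young diagram `Y` with `m` cells which is neither a single row nor a
single column (`rowLen 0, colLen 0 ≤ m - 1`), `m ≤ f^Y + 1`, except for the square `(2,2)` where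
`f = 2` (the correction term). [folklore] -/
private theorem linear_le_syt_aux : ∀ (m : ℕ) (Y : YoungDiagram), Y.cells.card = m →
    Y.rowLen 0 + 1 ≤ m → Y.colLen 0 + 1 ≤ m →
    m ≤ Nat.card (StdFilling Y.cells.card Y) + 1 + (if m = 4 ∧ Y.rowLen 0 = 2 then 1 else 0) := by
  intro m
  induction m using Nat.strong_induction_on with
  | _ m ih =>
    intro Y hY ha hb
    have hf1 := one_le_card_stdFilling Y
    by_cases hm2 : m ≤ 2
    · have : m ≤ Nat.card (StdFilling Y.cells.card Y) + 1 := by omega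
      exact le_add_right this
    -- case (i): first row of length `m - 1`
    by_cases hA : Y.rowLen 0 + 1 = m
    · exact le_add_right (hook_two_rows_bound m ih Y hY hA hb)
    -- case (ii): first column of length `m - 1` (transpose)
    by_cases hB : Y.colLen 0 + 1 = m
    · have hY' : Y.transpose.cells.card = m := by rw [YoungDiagram.card_transpose, hY]
      have key := hook_two_rows_bound m ih Y.transpose hY' (by rw [YoungDiagram.rowLen_transpose]; exact hB)
        (by rw [YoungDiagram.colLen_transpose]; exact ha)
      rw [card_stdFilling_transpose'] at key
      exact le_add_right key
    -- case (iii): both at most `m - 2`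
    have ha2 : Y.rowLen 0 + 2 ≤ m := by omega
    have hb2 : Y.colLen 0 + 2 ≤ m := by omega
    have hm4 : 4 ≤ m := by
      by_contra hlt
      have hbox := card_le_rowLen_mul_colLen Y
      have : Y.rowLen 0 * Y.colLen 0 ≤ 1 * 1 := Nat.mul_le_mul (by omega) (by omega)
      omega
    obtain ⟨n, rfl⟩ : ∃ n, m = n + 1 := ⟨m - 1, by omega⟩
    have hcol : 1 ≤ Y.colLen 0 := one_le_colLen_of_card_pos (by omega)
    have hlast : Y.rowLen (Y.colLen 0 - 1 + 1) < Y.rowLen (Y.colLen 0 - 1) := isCornerRow_last hcol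
    by_cases hex : ∃ r, r + 1 < Y.colLen 0 ∧ Y.rowLen (r + 1) < Y.rowLen r
    · -- two distinct corner rows
      obtain ⟨r, hr, hcr⟩ := hex
      obtain ⟨c1, a1, b1⟩ := removeAbove_not_line hcr hY ha2 hb2
      obtain ⟨c2, a2, b2⟩ := removeAbove_not_line hlast hY ha2 hb2
      have i1 := ih n (by omega) _ c1 a1 b1
      have i2 := ih n (by omega) _ c2 a2 b2
      have hsum := add_le_syt_of_isCornerRow hcr hlast (by omega)
      split_ifs at i1 i2 ⊢ <;> omega
    · -- a rectangle `a × b`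
      push Not at hex
      have hrect : ∀ r, r < Y.colLen 0 → Y.rowLen r = Y.rowLen 0 := fun r hr =>
        rowLen_eq_rowLen_zero_of_no_corner (fun r hr => not_lt.2 (hex r hr)) hr
      have hab : n + 1 = Y.rowLen 0 * Y.colLen 0 := hY ▸ card_eq_mul_of_rect hrect
      have ha2' : 2 ≤ Y.rowLen 0 := by
        by_contra hlt
        have := card_eq_colLen_of_rowLen_le_one (Y := Y) (by omega)
        omega
      have hb2' : 2 ≤ Y.colLen 0 := by
        by_contra hlt
        have := card_eq_rowLen_of_colLen_le_one (Y := Y) (by omega)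
        omega
      by_cases h22 : Y.rowLen 0 = 2 ∧ Y.colLen 0 = 2
      · -- the square `(2,2)`: `f ≥ f^{(2,1)} = 2`
        obtain ⟨hr2, hc2⟩ := h22
        rw [hr2, hc2] at hab
        have hn3 : n = 3 := by omega
        subst hn3
        rw [if_pos ⟨rfl, hr2⟩]
        have hZY := le_syt_of_isCornerRow hlast
        have cZ : (Y.removeAbove (Y.colLen 0 - 1, Y.rowLen (Y.colLen 0 - 1) - 1)).cells.card = 3 :=
          card_removeAbove_cornerCell hlast hY
        have aZ : (Y.removeAbove (Y.colLen 0 - 1, Y.rowLen (Y.colLen 0 - 1) - 1)).rowLen 0 = 2 := by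
          rw [rowLen_removeAbove_cornerCell_of_ne hlast (by omega), hr2]
        have bZ : (Y.removeAbove (Y.colLen 0 - 1, Y.rowLen (Y.colLen 0 - 1) - 1)).colLen 0 ≤ 2 := by
          have := colLen_le_of_le (removeAbove_le Y (Y.colLen 0 - 1, Y.rowLen (Y.colLen 0 - 1) - 1)) 0
          omega
        have iZ := ih 3 (by omega) _ cZ (by omega) (by omega)
        rw [if_neg (by omega)] at iZ
        omega
      · rw [if_neg (by omega)]
        by_cases hle : Y.colLen 0 ≤ Y.rowLen 0
        · have ha3 : 3 ≤ Y.rowLen 0 := by omega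
          exact le_add_right (rect_bound (n + 1) ih Y hY hab ha3 hb2' hrect rfl)
        · -- transpose: `b × a` with `b ≥ 3`
          have hb3 : 3 ≤ Y.colLen 0 := by omega
          have hY' : Y.transpose.cells.card = n + 1 := by rw [YoungDiagram.card_transpose, hY]
          have hrows' : ∀ r, r < Y.rowLen 0 → Y.transpose.rowLen r = Y.colLen 0 := fun r hr => by
            rw [YoungDiagram.rowLen_transpose]
            exact colLen_eq_of_rect hrect rfl hr
          have key := rect_bound (n + 1) ih Y.transpose hY' (by rw [hab, mul_comm]) hb3 ha2' hrows'
            (by rw [YoungDiagram.colLen_transpose])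
          rw [card_stdFilling_transpose'] at key
          exact le_add_right key

/-- **The linear lower bound.**  For every Young diagram `Y` with `|Y| ≥ 5` which is neither a single row
nor a single column, `|Y| - 1 ≤ f^Y` (as `|Y| ≤ f^Y + 1`). [folklore] -/
private theorem linear_le_syt {Y : YoungDiagram} (h5 : 5 ≤ Y.cells.card) (hrow : Y.rowLen 0 + 1 ≤ Y.cells.card)
    (hcol : Y.colLen 0 + 1 ≤ Y.cells.card) :
    Y.cells.card ≤ Nat.card (StdFilling Y.cells.card Y) + 1 := by
  have h := linear_le_syt_aux Y.cells.card Y rfl hrow hcol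
  rw [if_neg (by omega)] at h
  simpa using h

/-- **The linear lower bound for partitions**: for `μ ⊢ n`, `n ≥ 5`, all of whose parts are `≤ n - 1`
and which has at most `n - 1` parts (i.e. `μ ≠ (n), (1ⁿ)`), `n - 1 ≤ f^μ`. [folklore] -/
private theorem sub_one_le_numStandardTableaux {n : ℕ} (hn : 5 ≤ n) (μ : Nat.Partition n)
    (hrow : ∀ a ∈ μ.parts, a + 1 ≤ n) (hcol : μ.parts.card + 1 ≤ n) :
    n - 1 ≤ numStandardTableaux μ := by
  rw [numStandardTableaux_eq_card_stdFilling']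
  have hc := μ.card_cells_youngDiagram
  have h1 : μ.youngDiagram.rowLen 0 + 1 ≤ μ.youngDiagram.cells.card := by
    rw [hc]
    rcases rowLen_zero_mem_parts_or μ with h | h
    · exact hrow _ h
    · omega
  have h2 : μ.youngDiagram.colLen 0 + 1 ≤ μ.youngDiagram.cells.card := by
    rw [hc, colLen_zero_youngDiagram]; exact hcol
  have key := linear_le_syt (by omega) h1 h2
  omega

end Literature.RepresentationTheory.FiniteGroups.SpechtDim

end Part4

/-!
## Part 5 — port of `Summits/ValiantsHypothesis/ValiantsHypothesis/Theorems/MonotoneRestorationMixingScaleSpechtDimSelfConjugate.lean`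

# Self-conjugate shapes have `f^λ ≥ 2(n - 1)` (`n ≥ 6`)

Helper file (2/3) of the discharge of the named fact
`Literature.RepresentationTheory.FiniteGroups.JamesKerber1981_thm_2_5_15` (minimal degree `n - 1` of the
alternating group), filed for route MonotoneRestoration, crux `OrbitRestorationQP`
(stmt-ValiantsHypothesis-18293), line `mixing-scale` (its input `alternatingProductMixing` is reduced in the
tree to that fact).  In the index-two Clifford theory `𝔄_n ◁ 𝔖_n` an irreducible character `χ^λ` of `𝔖_n`
splits on `𝔄_n` only if `λ = λᵀ`; the two halves then have degree `f^λ / 2`, and this file supplies the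
bound that keeps them `≥ n - 1`:

* `two_mul_le_syt_of_transpose_eq` — **for every self-conjugate Young diagram `Y` (`Yᵀ = Y`) with
  `|Y| = n ≥ 6` cells, `2(n - 1) ≤ f^Y`** (as `2|Y| ≤ f^Y + 2`).

Proof.  Let `a = rowLen 0 = colLen 0`; then `Y` lies in the `a × a` box (`n ≤ a²`) and contains the hook
`K = (a, 1^{a-1})`, whose `f` is `C(2a-2, a-1)` (`choose_le_syt_hook`, Pascal recursion along the two
corners of a hook), so `f^Y ≥ C(2a-2, a-1)` by monotonicity (`card_stdFilling_mono`).  This settles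
`a ≥ 5` (`C(2a-2,a-1) ≥ 2a² - 2`) and the hooks themselves (`(1,1) ∉ Y`: `n = 2a - 1`, `a ≥ 4`).  For
`a ∈ {3, 4}` with `(1,1) ∈ Y` the near-hook `N = (a, 2, 1^{a-2}) ⊆ Y` has three corners whose removals
are the hook `K` and two shapes covered by the linear bound of `…SpechtDimLinear`, giving
`f^N ≥ C(2a-2,a-1) + 4a - 4 ∈ {14, 32}`; the one remaining shape, the `3 × 3` square (`n = 9`), has
`f = 42` by the hook length formula for rectangles (`numStandardTableaux_rectangle_mul_prod`).

References: G. James, A. Kerber, *The Representation Theory of the Symmetric Group* (1981), 2.5.7 and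
2.5.15; W. Fulton, *Young Tableaux* (1997), §7.2.  Honest framing: pure combinatorics; nothing here bears
on `VP ≠ VNP`.
-/

section Part5

namespace Literature.RepresentationTheory.FiniteGroups.SpechtDim

open Literature.NumberTheory.DiophantineGeometry Literature.RepresentationTheory.FiniteGroups
open Literature.RepresentationTheory.FiniteGroups.SpechtPolynomialSlack
open Literature.RepresentationTheory.FiniteGroups.YoungBounds

/-! ## Three corners -/

/-- **Branching inequality, three corners**: `f^{Y ⊖ c} + f^{Y ⊖ c'} + f^{Y ⊖ c''} ≤ f^{Y}` for corners in
three distinct rows. [folklore] -/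
private theorem add_add_le_syt_of_isCornerRow {Y : YoungDiagram} {r r' r'' : ℕ} (h : Y.rowLen (r + 1) < Y.rowLen r)
    (h' : Y.rowLen (r' + 1) < Y.rowLen r') (h'' : Y.rowLen (r'' + 1) < Y.rowLen r'')
    (h1 : r ≠ r') (h2 : r ≠ r'') (h3 : r' ≠ r'') :
    Nat.card (StdFilling (Y.removeAbove (r, Y.rowLen r - 1)).cells.card (Y.removeAbove (r, Y.rowLen r - 1))) +
      Nat.card (StdFilling (Y.removeAbove (r', Y.rowLen r' - 1)).cells.card (Y.removeAbove (r', Y.rowLen r' - 1))) +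
      Nat.card (StdFilling (Y.removeAbove (r'', Y.rowLen r'' - 1)).cells.card (Y.removeAbove (r'', Y.rowLen r'' - 1)))
      ≤ Nat.card (StdFilling Y.cells.card Y) := by
  classical
  obtain ⟨n, hY⟩ := exists_card_eq_succ_of_isCornerRow h
  have hbranch := StdFilling.card_stdFilling_succ n Y
  have e1 : Nat.card (StdFilling Y.cells.card Y) = Nat.card (StdFilling (n + 1) Y) := by rw [hY]
  have e2 : ∀ {s : ℕ} (hs : Y.rowLen (s + 1) < Y.rowLen s),
      Nat.card (StdFilling (Y.removeAbove (s, Y.rowLen s - 1)).cells.card (Y.removeAbove (s, Y.rowLen s - 1))) =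
        Nat.card (StdFilling n (Y.removeAbove (s, Y.rowLen s - 1))) := fun hs => by
    rw [card_removeAbove_cornerCell hs hY]
  rw [e1, e2 h, e2 h', e2 h'', hbranch]
  have hc12 : (r, Y.rowLen r - 1) ≠ (r', Y.rowLen r' - 1) := fun e => h1 (congrArg Prod.fst e)
  have hc13 : (r, Y.rowLen r - 1) ≠ (r'', Y.rowLen r'' - 1) := fun e => h2 (congrArg Prod.fst e)
  have hc23 : (r', Y.rowLen r' - 1) ≠ (r'', Y.rowLen r'' - 1) := fun e => h3 (congrArg Prod.fst e)
  have hsub : ({(r, Y.rowLen r - 1), (r', Y.rowLen r' - 1), (r'', Y.rowLen r'' - 1)} : Finset (ℕ × ℕ)) ⊆ Y.cells := by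
    intro c hc
    simp only [Finset.mem_insert, Finset.mem_singleton] at hc
    rcases hc with rfl | rfl | rfl
    · exact cornerCell_mem h
    · exact cornerCell_mem h'
    · exact cornerCell_mem h''
  calc Nat.card (StdFilling n (Y.removeAbove (r, Y.rowLen r - 1))) +
        Nat.card (StdFilling n (Y.removeAbove (r', Y.rowLen r' - 1))) +
        Nat.card (StdFilling n (Y.removeAbove (r'', Y.rowLen r'' - 1)))
      = ∑ c ∈ ({(r, Y.rowLen r - 1), (r', Y.rowLen r' - 1), (r'', Y.rowLen r'' - 1)} : Finset (ℕ × ℕ)),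
          Nat.card (StdFilling n (Y.removeAbove c)) := by
        rw [Finset.sum_insert (by simp [hc12, hc13]), Finset.sum_insert (by simp [hc23]),
          Finset.sum_singleton, add_assoc]
    _ ≤ _ := Finset.sum_le_sum_of_subset_of_nonneg hsub fun _ _ _ => Nat.zero_le _

/-! ## Hooks: `f^{(p, 1^q)} ≥ C(p + q - 1, q)` -/

/-- **The hook count.**  If `Y` is the hook `(p, 1^q)` (`rowLen 0 = p ≥ 1`, rows `1, …, q` of length `1`,
row `q + 1` empty) then `C(p+q-1, q) ≤ f^Y` (in fact equality; Pascal's rule along the two corners of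
the hook). [folklore] -/
private theorem choose_le_syt_hook : ∀ (s : ℕ) (Y : YoungDiagram) (p q : ℕ), p + q = s → 1 ≤ p →
    Y.rowLen 0 = p → (∀ r, 1 ≤ r → r ≤ q → Y.rowLen r = 1) → Y.rowLen (q + 1) = 0 →
    (p + q - 1).choose q ≤ Nat.card (StdFilling Y.cells.card Y) := by
  intro s
  induction s with
  | zero => intro Y p q hs hp; omega
  | succ s ih =>
    intro Y p q hs hp h0 hmid hend
    have hf1 := one_le_card_stdFilling Y
    by_cases hq : q = 0
    · subst hq; simpa using hf1
    by_cases hp1 : p = 1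
    · subst hp1; simpa using hf1
    obtain ⟨q', rfl⟩ : ∃ q', q = q' + 1 := ⟨q - 1, by omega⟩
    -- the two corners: row `0` and row `q`
    have hc0 : Y.rowLen (0 + 1) < Y.rowLen 0 := by rw [h0, hmid 1 le_rfl (by omega)]; omega
    have hcq : Y.rowLen (q' + 1 + 1) < Y.rowLen (q' + 1) := by
      rw [hend, hmid (q' + 1) (by omega) le_rfl]; omega
    have hbr := add_le_syt_of_isCornerRow hc0 hcq (by omega)
    -- the child `(p-1, 1^q)`
    have i0 := ih (Y.removeAbove (0, Y.rowLen 0 - 1)) (p - 1) (q' + 1) (by omega) (by omega)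
      (by rw [rowLen_removeAbove_cornerCell_self hc0, h0])
      (fun r hr1 hrq => by rw [rowLen_removeAbove_cornerCell_of_ne hc0 (by omega)]; exact hmid r hr1 hrq)
      (by rw [rowLen_removeAbove_cornerCell_of_ne hc0 (by omega)]; exact hend)
    -- the child `(p, 1^{q-1})`
    have iq := ih (Y.removeAbove (q' + 1, Y.rowLen (q' + 1) - 1)) p q' (by omega) hp
      (by rw [rowLen_removeAbove_cornerCell_of_ne hcq (by omega), h0])
      (fun r hr1 hrq => by rw [rowLen_removeAbove_cornerCell_of_ne hcq (by omega)]; exact hmid r hr1 (by omega))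
      (by rw [rowLen_removeAbove_cornerCell_self hcq, hmid (q' + 1) (by omega) le_rfl])
    have e1 : p - 1 + (q' + 1) - 1 = p + q' - 1 := by omega
    have e2 : p + (q' + 1) - 1 = (p + q' - 1) + 1 := by omega
    rw [e1] at i0
    rw [e2, Nat.choose_succ_succ']
    omega

/-! ## Binomial arithmetic -/

/-- `C(2k, k) ≥ 2k² + 4k` for `k ≥ 4`. [folklore] -/
private theorem two_mul_sq_le_centralBinom {k : ℕ} (hk : 4 ≤ k) : 2 * k ^ 2 + 4 * k ≤ Nat.centralBinom k := by
  induction k with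
  | zero => omega
  | succ k ih =>
    rcases Nat.lt_or_ge k 4 with hlt | hge
    · have hk4 : k = 3 := by omega
      subst hk4
      decide
    · have h := Nat.succ_mul_centralBinom_succ k
      have ih' := ih hge
      -- `(k+1) C_{k+1} = 2(2k+1) C_k ≥ 2(k+1) C_k`, so `C_{k+1} ≥ 2 C_k`
      have h2 : (k + 1) * (2 * Nat.centralBinom k) ≤ (k + 1) * Nat.centralBinom (k + 1) := by
        rw [h]; nlinarith [Nat.centralBinom_pos k]
      have h3 : 2 * Nat.centralBinom k ≤ Nat.centralBinom (k + 1) := Nat.le_of_mul_le_mul_left h2 (by omega)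
      nlinarith

/-- `C(2a-2, a-1) ≥ 2a² - 2` for `a ≥ 5` (as `2a² ≤ C + 2`). [folklore] -/
private theorem two_mul_sq_le_choose_add_two {a : ℕ} (ha : 5 ≤ a) : 2 * a ^ 2 ≤ (2 * a - 2).choose (a - 1) + 2 := by
  obtain ⟨k, rfl⟩ : ∃ k, a = k + 1 := ⟨a - 1, by omega⟩
  have h := two_mul_sq_le_centralBinom (k := k) (by omega)
  rw [Nat.centralBinom_eq_two_mul_choose] at h
  rw [show 2 * (k + 1) - 2 = 2 * k by omega, show k + 1 - 1 = k by omega]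
  nlinarith

/-! ## The explicit sub-diagrams: the hook `(a, 1^{a-1})` and the near-hook `(a, 2, 1^{a-2})` -/

/-- The hook `K_a = (a, 1^{a-1})` as a Young diagram, with its membership. [folklore] -/
private theorem exists_hook_diagram (a : ℕ) :
    ∃ K : YoungDiagram, ∀ c : ℕ × ℕ, c ∈ K ↔ (c.1 = 0 ∧ c.2 < a) ∨ (c.2 = 0 ∧ c.1 < a) := by
  classical
  refine ⟨⟨(Finset.range a).image (fun j => ((0 : ℕ), j)) ∪ (Finset.range a).image (fun i => (i, (0 : ℕ))), ?_⟩, ?_⟩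
  · -- lower set
    intro x y hyx hx
    simp only [Finset.coe_union, Finset.coe_image, Finset.coe_range, Set.mem_union, Set.mem_image,
      Set.mem_Iio] at hx ⊢
    obtain ⟨h1, h2⟩ := Prod.mk_le_mk.1 (show (y.1, y.2) ≤ (x.1, x.2) from hyx)
    rcases hx with ⟨j, hj, hxe⟩ | ⟨i, hi, hxe⟩
    · left; refine ⟨y.2, ?_, ?_⟩
      · rw [← hxe] at h2; simp at h2; omega
      · rw [← hxe] at h1; simp at h1; ext <;> simp [h1]
    · right; refine ⟨y.1, ?_, ?_⟩
      · rw [← hxe] at h1; simp at h1; omega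
      · rw [← hxe] at h2; simp at h2; ext <;> simp [h2]
  · intro c
    show c ∈ (Finset.range a).image (fun j => ((0 : ℕ), j)) ∪ (Finset.range a).image (fun i => (i, (0 : ℕ))) ↔ _
    simp only [Finset.mem_union, Finset.mem_image, Finset.mem_range]
    constructor
    · rintro (⟨j, hj, rfl⟩ | ⟨i, hi, rfl⟩)
      · exact Or.inl ⟨rfl, hj⟩
      · exact Or.inr ⟨rfl, hi⟩
    · rintro (⟨h1, h2⟩ | ⟨h1, h2⟩)
      · exact Or.inl ⟨c.2, h2, by ext <;> simp [h1]⟩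
      · exact Or.inr ⟨c.1, h2, by ext <;> simp [h1]⟩

/-- The near-hook `N_a = (a, 2, 1^{a-2})` (`a ≥ 2`) as a Young diagram, with its membership. [folklore] -/
private theorem exists_nearHook_diagram {a : ℕ} (ha : 2 ≤ a) :
    ∃ N : YoungDiagram, ∀ c : ℕ × ℕ, c ∈ N ↔ (c.1 = 0 ∧ c.2 < a) ∨ (c.2 = 0 ∧ c.1 < a) ∨ c = (1, 1) := by
  classical
  obtain ⟨K, hK⟩ := exists_hook_diagram a
  refine ⟨⟨insert ((1 : ℕ), (1 : ℕ)) K.cells, ?_⟩, ?_⟩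
  · intro x y hyx hx
    simp only [Finset.coe_insert, Set.mem_insert_iff, Finset.mem_coe, YoungDiagram.mem_cells] at hx ⊢
    obtain ⟨h1, h2⟩ := Prod.mk_le_mk.1 (show (y.1, y.2) ≤ (x.1, x.2) from hyx)
    rcases hx with hx | hx
    · rw [hx] at h1 h2
      simp at h1 h2
      by_cases hy : y = (1, 1)
      · exact Or.inl hy
      · right
        rw [hK]
        have : y.1 = 0 ∨ y.2 = 0 := by
          by_contra hno
          push Not at hno
          exact hy (Prod.ext (by omega) (by omega))
        rcases this with h | h
        · exact Or.inl ⟨h, by omega⟩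
        · exact Or.inr ⟨h, by omega⟩
    · exact Or.inr (K.isLowerSet hyx hx)
  · intro c
    show c ∈ insert ((1 : ℕ), (1 : ℕ)) K.cells ↔ _
    rw [Finset.mem_insert, YoungDiagram.mem_cells, hK]
    tauto

/-! ## The main estimate -/

/-- **Self-conjugate shapes.**  For every Young diagram `Y` with `Yᵀ = Y` and `|Y| ≥ 6`,
`2(|Y| - 1) ≤ f^Y` (as `2|Y| ≤ f^Y + 2`). [folklore] -/
private theorem two_mul_le_syt_of_transpose_eq {Y : YoungDiagram} (hY : Y.transpose = Y) (h6 : 6 ≤ Y.cells.card) :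
    2 * Y.cells.card ≤ Nat.card (StdFilling Y.cells.card Y) + 2 := by
  classical
  set a := Y.rowLen 0 with ha_def
  have hcolY : Y.colLen 0 = a := by rw [← YoungDiagram.rowLen_transpose, hY]
  have hbox : Y.cells.card ≤ a * a := by
    have := card_le_rowLen_mul_colLen Y; rwa [hcolY] at this
  have ha3 : 3 ≤ a := by
    by_contra hlt
    have : a * a ≤ 2 * 2 := Nat.mul_le_mul (by omega) (by omega)
    omega
  -- the hook `K = (a, 1^{a-1}) ⊆ Y`
  obtain ⟨K, hK⟩ := exists_hook_diagram a
  have hKsub : K.cells ⊆ Y.cells := by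
    intro c hc
    rw [YoungDiagram.mem_cells] at hc ⊢
    rcases (hK c).1 hc with ⟨h1, h2⟩ | ⟨h1, h2⟩
    · have : (c.1, c.2) ∈ Y := YoungDiagram.mem_iff_lt_rowLen.2 (by rw [h1]; exact h2)
      simpa using this
    · have : (c.1, c.2) ∈ Y := YoungDiagram.mem_iff_lt_colLen.2 (by rw [h1, hcolY]; exact h2)
      simpa using this
  have hK0 : K.rowLen 0 = a := YoungDiagram.rowLen_eq_of_forall_mem_iff fun j => by
    rw [hK]; simp; omega
  have hKmid : ∀ r, 1 ≤ r → r ≤ a - 1 → K.rowLen r = 1 := fun r hr1 hr2 =>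
    YoungDiagram.rowLen_eq_of_forall_mem_iff fun j => by rw [hK]; simp; omega
  have hKend : K.rowLen (a - 1 + 1) = 0 := YoungDiagram.rowLen_eq_of_forall_mem_iff fun j => by
    rw [hK]; simp; omega
  have hfK : (a + (a - 1) - 1).choose (a - 1) ≤ Nat.card (StdFilling K.cells.card K) :=
    choose_le_syt_hook _ K a (a - 1) rfl (by omega) hK0 hKmid hKend
  rw [show a + (a - 1) - 1 = 2 * a - 2 by omega] at hfK
  have hKY : Nat.card (StdFilling K.cells.card K) ≤ Nat.card (StdFilling Y.cells.card Y) :=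
    card_stdFilling_mono (Y.cells.card - K.cells.card) K Y hKsub (by have := Finset.card_le_card hKsub; omega)
  -- case `a ≥ 5`: the hook suffices
  by_cases ha5 : 5 ≤ a
  · have hb := two_mul_sq_le_choose_add_two ha5
    nlinarith
  -- case `(1,1) ∉ Y`: `Y` is the hook itself, `n ≤ 2a - 1`, and `a = 4`
  by_cases h11 : (1, 1) ∉ Y
  · have hYK : Y.cells ⊆ K.cells := by
      intro c hc
      rw [YoungDiagram.mem_cells] at hc ⊢
      rw [hK]
      have hc1 : c.1 < Y.colLen 0 := YoungDiagram.mem_iff_lt_colLen.1 (by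
        have : (c.1, 0) ≤ (c.1, c.2) := Prod.mk_le_mk.2 ⟨le_rfl, Nat.zero_le _⟩
        exact Y.isLowerSet this hc)
      have hc2 : c.2 < Y.rowLen 0 := YoungDiagram.mem_iff_lt_rowLen.1 (by
        have : (0, c.2) ≤ (c.1, c.2) := Prod.mk_le_mk.2 ⟨Nat.zero_le _, le_rfl⟩
        exact Y.isLowerSet this hc)
      rw [hcolY] at hc1
      by_contra hno
      push Not at hno
      have h1' : c.1 ≠ 0 := fun h => absurd (hno.1 h) (by omega)
      have h2' : c.2 ≠ 0 := fun h => absurd (hno.2 h) (by omega)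
      exact h11 (Y.isLowerSet (Prod.mk_le_mk.2 ⟨Nat.one_le_iff_ne_zero.2 h1', Nat.one_le_iff_ne_zero.2 h2'⟩) hc)
    have hKcard : K.cells.card ≤ a + a - 1 := by
      have hKcells : K.cells ⊆ (Finset.range a).image (fun j => ((0 : ℕ), j)) ∪
          (Finset.range (a - 1)).image (fun i => (i + 1, (0 : ℕ))) := by
        intro c hc
        rw [YoungDiagram.mem_cells, hK] at hc
        simp only [Finset.mem_union, Finset.mem_image, Finset.mem_range]
        rcases hc with ⟨h1, h2⟩ | ⟨h1, h2⟩
        · exact Or.inl ⟨c.2, h2, by ext <;> simp [h1]⟩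
        · by_cases hc0 : c.1 = 0
          · exact Or.inl ⟨c.2, by omega, Prod.ext (by simp [hc0]) rfl⟩
          · exact Or.inr ⟨c.1 - 1, by omega, Prod.ext (by dsimp only; omega) (by simp [h1])⟩
      calc K.cells.card ≤ _ := Finset.card_le_card hKcells
        _ ≤ ((Finset.range a).image (fun j => ((0 : ℕ), j))).card +
              ((Finset.range (a - 1)).image (fun i => (i + 1, (0 : ℕ)))).card := Finset.card_union_le _ _
        _ ≤ a + (a - 1) := by
            gcongr
            · exact (Finset.card_image_le).trans (by simp)
            · exact (Finset.card_image_le).trans (by simp)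
        _ = a + a - 1 := by omega
    have hn : Y.cells.card ≤ 2 * a - 1 := by have := Finset.card_le_card hYK; omega
    have ha4 : a = 4 := by omega
    rw [ha4] at hfK
    have : (2 * 4 - 2).choose (4 - 1) = 20 := by decide
    omega
  -- case `(1,1) ∈ Y`, `a ∈ {3,4}`: the near-hook `N = (a, 2, 1^{a-2}) ⊆ Y`
  push Not at h11
  obtain ⟨N, hN⟩ := exists_nearHook_diagram (a := a) (by omega)
  have hNsub : N.cells ⊆ Y.cells := by
    intro c hc
    rw [YoungDiagram.mem_cells] at hc ⊢
    rcases (hN c).1 hc with h | h | h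
    · exact (YoungDiagram.mem_cells _).1 (hKsub ((YoungDiagram.mem_cells _).2 ((hK c).2 (Or.inl h))))
    · exact (YoungDiagram.mem_cells _).1 (hKsub ((YoungDiagram.mem_cells _).2 ((hK c).2 (Or.inr h))))
    · rw [h]; exact h11
  have hN0 : N.rowLen 0 = a := YoungDiagram.rowLen_eq_of_forall_mem_iff fun j => by
    rw [hN]; simp; omega
  have hN1 : N.rowLen 1 = 2 := YoungDiagram.rowLen_eq_of_forall_mem_iff fun j => by
    rw [hN]; simp; omega
  have hNmid : ∀ r, 2 ≤ r → r < a → N.rowLen r = 1 := fun r hr1 hr2 =>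
    YoungDiagram.rowLen_eq_of_forall_mem_iff fun j => by rw [hN]; simp; omega
  have hNa : N.rowLen a = 0 := YoungDiagram.rowLen_eq_of_forall_mem_iff fun j => by
    rw [hN]; simp; omega
  have hNcol : N.colLen 0 = a := YoungDiagram.colLen_eq_of_forall_mem_iff fun i => by
    rw [hN]; simp; omega
  have hNcard : N.cells.card = 2 * a := by
    rw [card_eq_sum_rowLen, hNcol]
    obtain ⟨b, hb⟩ : ∃ b, a = b + 2 := ⟨a - 2, by omega⟩
    rw [hb, Finset.sum_range_succ', Finset.sum_range_succ']
    rw [Finset.sum_congr rfl fun r hr => hNmid (r + 1 + 1) (by omega) (by have := Finset.mem_range.1 hr; omega)]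
    simp [hN0, hN1]; omega
  -- the three corners of `N`: rows `0`, `1`, `a - 1`
  have hc0 : N.rowLen (0 + 1) < N.rowLen 0 := by rw [hN1, hN0]; omega
  have hc1 : N.rowLen (1 + 1) < N.rowLen 1 := by
    rw [hN1]
    rcases Nat.lt_or_ge 2 a with h | h
    · rw [hNmid 2 le_rfl h]; omega
    · rw [show a = 2 by omega] at hNa; simp only [Nat.reduceAdd]; rw [hNa]; omega
  have hcl : N.rowLen (a - 1 + 1) < N.rowLen (a - 1) := by
    rw [show a - 1 + 1 = a by omega, hNa, hNmid (a - 1) (by omega) (by omega)]; omega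
  have hbr := add_add_le_syt_of_isCornerRow hc0 hc1 hcl (by omega) (by omega) (by omega)
  have hNY : Nat.card (StdFilling N.cells.card N) ≤ Nat.card (StdFilling Y.cells.card Y) :=
    card_stdFilling_mono (Y.cells.card - N.cells.card) N Y hNsub (by have := Finset.card_le_card hNsub; omega)
  -- removal at row `0`: `(a-1, 2, 1^{a-2})`, linear bound
  have hR0c : (N.removeAbove (0, N.rowLen 0 - 1)).cells.card = 2 * a - 1 := by
    rw [card_removeAbove_cornerCell hc0 (n := 2 * a - 1) (by rw [hNcard]; omega)]
  have hR0 := linear_le_syt (Y := N.removeAbove (0, N.rowLen 0 - 1)) (by omega)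
    (by have := rowLen_removeAbove_cornerCell_self hc0; omega)
    (by have := colLen_le_of_le (removeAbove_le N (0, N.rowLen 0 - 1)) 0; omega)
  -- removal at row `1`: the hook `(a, 1^{a-1})`
  have hR1 := choose_le_syt_hook _ (N.removeAbove (1, N.rowLen 1 - 1)) a (a - 1) rfl (by omega)
    (by rw [rowLen_removeAbove_cornerCell_of_ne hc1 (by omega), hN0])
    (fun r hr1 hr2 => by
      by_cases hr : r = 1
      · subst hr; rw [rowLen_removeAbove_cornerCell_self hc1, hN1]
      · rw [rowLen_removeAbove_cornerCell_of_ne hc1 hr]; exact hNmid r (by omega) (by omega))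
    (by rw [rowLen_removeAbove_cornerCell_of_ne hc1 (by omega), show a - 1 + 1 = a by omega, hNa])
  rw [show a + (a - 1) - 1 = 2 * a - 2 by omega] at hR1
  -- removal at row `a - 1`: `(a, 2, 1^{a-3})`, linear bound
  have hRlc : (N.removeAbove (a - 1, N.rowLen (a - 1) - 1)).cells.card = 2 * a - 1 := by
    rw [card_removeAbove_cornerCell hcl (n := 2 * a - 1) (by rw [hNcard]; omega)]
  have hRl := linear_le_syt (Y := N.removeAbove (a - 1, N.rowLen (a - 1) - 1)) (by omega)
    (by have := rowLen_removeAbove_cornerCell_of_ne hcl (i := 0) (by omega); omega)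
    (by have := colLen_le_of_le (removeAbove_le N (a - 1, N.rowLen (a - 1) - 1)) 0; omega)
  -- `a = 4`: `12 + 20 = 32 ≥ 30`; `a = 3`: `8 + 6 = 14` covers `n ≤ 8`
  rcases (show a = 3 ∨ a = 4 by omega) with ha | ha
  · rw [ha] at hR1 hbox
    have e : (2 * 3 - 2).choose (3 - 1) = 6 := by decide
    rw [e] at hR1
    by_cases hn9 : Y.cells.card ≤ 8
    · omega
    · -- `Y` is the `3 × 3` square: `f = 42`
      have hn : Y.cells.card = 9 := by omega
      have hcells : Y.cells = (Nat.Partition.rectangle 3 3).youngDiagram.cells := by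
        apply Finset.eq_of_subset_of_card_le
        · intro c hc
          rw [YoungDiagram.mem_cells] at hc ⊢
          rw [Literature.Computability.Complexity.mem_youngDiagram_rectangle]
          have hc1 : c.1 < Y.colLen c.2 := YoungDiagram.mem_iff_lt_colLen.1 hc
          have hc2 : c.2 < Y.rowLen c.1 := YoungDiagram.mem_iff_lt_rowLen.1 hc
          have := Y.colLen_anti 0 c.2 (Nat.zero_le _)
          have := Y.rowLen_anti 0 c.1 (Nat.zero_le _)
          omega
        · rw [(Nat.Partition.rectangle 3 3).card_cells_youngDiagram, hn]
      have hYeq : Y = (Nat.Partition.rectangle 3 3).youngDiagram := YoungDiagram.ext hcells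
      have h42 := Literature.Computability.AlgebraicComplexity.numStandardTableaux_rectangle_mul_prod 3 3
      rw [numStandardTableaux_eq_card_stdFilling', ← hYeq] at h42
      have hprod : ∏ i ∈ Finset.range 3, ∏ j ∈ Finset.range 3, (i + 1 + (j + 1) - 1) = 8640 := by decide
      have hfact : (3 * 3).factorial = 362880 := by decide
      rw [hprod, hfact] at h42
      omega
  · rw [ha] at hR1 hbox
    have e : (2 * 4 - 2).choose (4 - 1) = 20 := by decide
    rw [e] at hR1
    omega

end Literature.RepresentationTheory.FiniteGroups.SpechtDim

end Part5

/-!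
## Part 6 — port of `Summits/ValiantsHypothesis/ValiantsHypothesis/Theorems/MonotoneRestorationMixingScaleAlternatingMinimalDegree.lean`

# The minimal degree of `𝔄_n` is `n - 1` (James–Kerber 2.5.15): DISCHARGE of the named fact, and
# product mixing in `𝔄_n` (Babai–Nikolov–Pyber) as a theorem

File 3/3 filed for route MonotoneRestoration, crux `OrbitRestorationQP` (stmt-ValiantsHypothesis-18293),
line `mixing-scale` (val-idea-12): its registered input `AlternatingMixing` is the named fact
`Literature.GroupTheory.QuasirandomGroups.alternatingProductMixing` (hypothesis `hmix` of
`stub_almostInvariantTerms`, `growingFaninRestoration_of`, …), which the tree reduces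
(`alternatingProductMixing_of_minDegree`, Gowers' theorem being PROVED as `Gowers2008_thm_3_3_holds`) to the
typed fact `Literature.RepresentationTheory.FiniteGroups.JamesKerber1981_thm_2_5_15`:
for `n ∉ {3, 4, 5}` every non-trivial irreducible complex representation of `𝔄_n` has dimension `≥ n - 1`.

* `JamesKerber1981_thm_2_5_15_holds : JamesKerber1981_thm_2_5_15` — **PROVED** (its statement verbatim);
* `alternatingProductMixing_holds : alternatingProductMixing` — hence PROVED.

## Proof (Clifford theory of index two over the Specht layer; not the printed branching-table argument)

For `n ≤ 2` the group is trivial (`alternatingGroup.eq_bot_of_card_le_two`), so let `n ≥ 6`, `ρ` irreducible on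
`V`, `d = dim V`, some `ρ g ≠ 1`.  Then `d ≠ 1`: a line carries only scalars, which commute, so a
one-dimensional `ρ` kills `[𝔄_n, 𝔄_n] = 𝔄_n` (`commutator_alternatingGroup_eq_top`).  The character `χ` of `ρ`
lies under an irreducible character `θ` of `𝔖_n` (an irreducible constituent of `Ind χ`, Frobenius
reciprocity `classInner_indClassFun_left`), and `θ = χ^μ` is a Specht character (`irrChars_perm_eq`) of
degree `f^μ` (`finrank_spechtIdeal_holds`).  By J–L 20.9 (`isIrrChar_restrict_or_of_index_two`) either
`θ↓𝔄_n = χ`, so `d = f^μ ≥ 2`, `μ` is neither a row nor a column (`χ^{(n)} = 1`, `χ^{(1ⁿ)} = sgn` restrict to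
`1`) and `f^μ ≥ n - 1` by the linear bound `SpechtDim.linear_le_syt` (file 1/3); or `θ↓𝔄_n = ψ₁ + ψ₂` with
`χ ∈ {ψ₁, ψ₂}`, `2d = f^μ`, `⟨θ↓, θ↓⟩ = 2 = [𝔖_n : 𝔄_n]` so `θ` vanishes off `𝔄_n` (J–L 20.5,
`classInner_restrict_eq_index_iff`), whence `χ^{μᵀ} = sgn · χ^{μ} = χ^{μ}` (`spechtCharacter_transpose`),
`μᵀ = μ` (`spechtCharacter_injective`), and `f^μ ≥ 2(n - 1)` by the self-conjugate bound
`SpechtDim.two_mul_le_syt_of_transpose_eq` (file 2/3).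

References: G. James, A. Kerber, *The Representation Theory of the Symmetric Group*, Encyclopedia Math.
Appl. 16 (1981), Thm. 2.5.15; G. James, M. Liebeck, *Representations and Characters of Groups* (2001),
Props. 20.5, 20.9, Thm. 20.13/Ex. 20.14; L. Babai, N. Nikolov, L. Pyber, SODA 2008, and W. T. Gowers,
*Quasirandom groups* (2008), Thm. 3.3.  Honest framing: two Literature facts become theorems; the crux
`OrbitRestorationQP`, the line's residual and `VP ≠ VNP` remain OPEN — nothing here is progress on `VP ≠ VNP`.
-/

section Part6


namespace Literature.RepresentationTheory.FiniteGroups.AlternatingMinimalDegree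

open Module Literature.RepresentationTheory.FiniteGroups Literature.NumberTheory.DiophantineGeometry
open Literature.RepresentationTheory.FiniteGroups.SpechtPolynomialSlack
open Literature.RepresentationTheory.FiniteGroups.SpechtDim

/-- An endomorphism of a one-dimensional space is a scalar. [folklore] -/
private theorem exists_eq_smul_id_of_finrank_eq_one {V : Type*} [AddCommGroup V] [Module ℂ V]
    (h : finrank ℂ V = 1) (f : V →ₗ[ℂ] V) : ∃ c : ℂ, f = c • LinearMap.id := by
  obtain ⟨v, -, hspan⟩ := finrank_eq_one_iff'.mp h
  obtain ⟨c, hc⟩ := hspan (f v)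
  refine ⟨c, LinearMap.ext fun w => ?_⟩
  obtain ⟨a, rfl⟩ := hspan w
  rw [map_smul, ← hc, LinearMap.smul_apply, LinearMap.id_apply, smul_smul, smul_smul, mul_comm]

/-- A one-dimensional complex representation of the perfect group `𝔄_n` (`n ≥ 5`) is trivial.
[folklore] -/
private theorem apply_eq_id_of_finrank_eq_one {n : ℕ} (h5 : 5 ≤ n) {V : Type*} [AddCommGroup V]
    [Module ℂ V] (ρ : Representation ℂ ↥(alternatingGroup (Fin n)) V) (h1 : finrank ℂ V = 1)
    (g : ↥(alternatingGroup (Fin n))) : ρ g = LinearMap.id := by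
  have hcomm : ∀ a b : ↥(alternatingGroup (Fin n)), ρ a * ρ b = ρ b * ρ a := by
    intro a b
    obtain ⟨ca, ha⟩ := exists_eq_smul_id_of_finrank_eq_one h1 (ρ a)
    obtain ⟨cb, hb⟩ := exists_eq_smul_id_of_finrank_eq_one h1 (ρ b)
    rw [ha, hb]
    ext v
    simp [smul_smul, mul_comm]
  have hker : commutator ↥(alternatingGroup (Fin n)) ≤ ρ.ker := by
    rw [commutator_def, Subgroup.commutator_le]
    intro a _ b _
    rw [MonoidHom.mem_ker, commutatorElement_def,
      show a * b * a⁻¹ * b⁻¹ = (a * b) * (a⁻¹ * b⁻¹) by group, map_mul, map_mul ρ a b, hcomm a b,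
      ← map_mul, ← map_mul, show b * a * (a⁻¹ * b⁻¹) = 1 by group, map_one]
  have htop : commutator ↥(alternatingGroup (Fin n)) = ⊤ :=
    commutator_alternatingGroup_eq_top (by simpa using h5)
  have hg : g ∈ ρ.ker := hker (htop ▸ Subgroup.mem_top g)
  rw [MonoidHom.mem_ker] at hg
  rw [hg]
  rfl

/-- **James–Kerber, Theorem 2.5.15 (i)–(ii), PROVED**: for `n ∉ {3, 4, 5}`, every irreducible complex
representation of `𝔄_n = alternatingGroup (Fin n)` on which some element acts non-trivially has dimension
`≥ n - 1` — the named fact `Literature.RepresentationTheory.FiniteGroups.JamesKerber1981_thm_2_5_15`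
verbatim (Clifford theory of index two over the tree's Specht layer, see the module docstring).
[cite: JamesKerber1981, Thm. 2.5.15 (i)–(ii)] [cite: JamesLiebeck2001, Props. 20.5, 20.9] -/
theorem jamesKerber_minDegree_of_spechtDim : JamesKerber1981_thm_2_5_15 := by
  intro n h3 h4 h5 V _ _ _ ρ hρ hne
  obtain ⟨g0, hg0⟩ := hne
  -- `n ≥ 6`: for `n ≤ 2` the group is trivial
  have hn6 : 6 ≤ n := by
    by_contra hlt
    have hn2 : Nat.card (Fin n) ≤ 2 := by simp; omega
    have hbot := alternatingGroup.eq_bot_of_card_le_two hn2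
    apply hg0
    have hg1 : g0 = 1 := Subtype.ext (Subgroup.mem_bot.1 (hbot.le g0.2))
    rw [hg1, map_one]
    rfl
  -- `d ≠ 1` (perfectness) and `d ≠ 0`
  have hd1 : finrank ℂ V ≠ 1 := fun h1 => hg0 (apply_eq_id_of_finrank_eq_one (by omega) ρ h1 g0)
  have hd0 : finrank ℂ V ≠ 0 := by
    intro h0
    haveI : Subsingleton V := Module.finrank_zero_iff.mp h0
    exact hg0 (LinearMap.ext fun v => Subsingleton.elim _ _)
  -- the character of `ρ`
  have hχ : IsIrrChar ↥(alternatingGroup (Fin n)) ρ.character := ⟨V, _, _, ‹_›, ρ, hρ, rfl⟩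
  have hχ1 : ρ.character 1 = finrank ℂ V := ρ.char_one
  haveI : Nontrivial (Fin n) := Fin.nontrivial_iff_two_le.mpr (by omega)
  have hidx : (alternatingGroup (Fin n)).index = 2 := alternatingGroup.index_eq_two
  -- `χ` lies under an irreducible character `θ` of `𝔖_n`
  have hφ : IsCharacter (Equiv.Perm (Fin n)) (indClassFun (alternatingGroup (Fin n)) ρ.character) :=
    hχ.isCharacter.indClassFun _
  have hφ0 : indClassFun (alternatingGroup (Fin n)) ρ.character ≠ 0 := by
    intro h0
    have h := congrFun h0 1
    rw [indClassFun_apply_one_eq_index_mul, hidx, hχ1, Pi.zero_apply] at h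
    exact mul_ne_zero two_ne_zero (Nat.cast_ne_zero.mpr hd0) (by exact_mod_cast h)
  obtain ⟨θ, hθ, hθne⟩ := hφ.exists_isIrrChar_classInner_ne_zero hφ0
  rw [classInner_indClassFun_left _ _ hθ.isCharacter.isClassFun] at hθne
  -- from here on `hθne : ⟨χ, θ|H⟩ ≠ 0`
  obtain ⟨μ, hμ⟩ : ∃ μ : Nat.Partition n, spechtCharacter ℂ μ = θ := by
    have hmem : θ ∈ irrChars (Equiv.Perm (Fin n)) := hθ
    rw [irrChars_perm_eq] at hmem
    exact hmem
  have hθ1 : θ 1 = numStandardTableaux μ := by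
    rw [← hμ]
    show (spechtRep ℂ μ).character 1 = _
    rw [Representation.char_one, finrank_spechtIdeal_holds ℂ μ]
  have hYcard : μ.youngDiagram.cells.card = n := μ.card_cells_youngDiagram
  have hfY : numStandardTableaux μ = Nat.card (StdFilling μ.youngDiagram.cells.card μ.youngDiagram) :=
    numStandardTableaux_eq_card_stdFilling' μ
  -- the trivial character of `H` and `χ ≠ 1`
  have h11 : IsIrrChar ↥(alternatingGroup (Fin n)) (1 : ↥(alternatingGroup (Fin n)) → ℂ) := by
    have h := character_trivial_mem_irrChars (G := ↥(alternatingGroup (Fin n)))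
    have h1 : (Representation.trivial ℂ ↥(alternatingGroup (Fin n)) ℂ).character = 1 := by
      funext x; simp [Representation.character]
    rwa [h1] at h
  have hχne1 : ρ.character ≠ 1 := by
    intro hc
    have := congrFun hc 1
    rw [hχ1, Pi.one_apply] at this
    exact hd1 (by exact_mod_cast this)
  -- if `θ|H = 1` we are done by contradiction
  have hres_ne_one : (fun x : ↥(alternatingGroup (Fin n)) => θ x) ≠ 1 := by
    intro hres
    rw [hres, hχ.classInner_eq h11, if_neg hχne1] at hθne
    exact hθne rfl
  -- exclude the one-row shape
  have hrow : μ.youngDiagram.rowLen 0 + 1 ≤ n := by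
    by_contra hlt
    have hle : μ.youngDiagram.rowLen 0 ≤ μ.youngDiagram.cells.card := by
      rw [YoungDiagram.rowLen_eq_card]
      exact Finset.card_le_card fun c hc => (YoungDiagram.mem_cells _).2 (YoungDiagram.mem_row_iff.1 hc).1
    have heq : μ.youngDiagram.rowLen 0 = n := by omega
    rcases rowLen_zero_mem_parts_or μ with hmemp | hz
    · rcases sortedParts_of_exists_large_part μ hmemp (by omega) with hs | hs
      · apply hres_ne_one
        funext x
        rw [← hμ, spechtCharacter_of_sortedParts_eq_single μ hs]
        rfl
      · have hmem' : μ.youngDiagram.rowLen 0 ∈ μ.sortedParts := (Multiset.mem_sort _).2 hmemp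
        rw [hs, heq] at hmem'
        simp only [List.mem_cons, List.not_mem_nil, or_false] at hmem'
        omega
    · omega
  -- exclude the one-column shape
  have hcol : μ.youngDiagram.colLen 0 + 1 ≤ n := by
    by_contra hlt
    rw [colLen_zero_youngDiagram] at hlt
    rcases sortedParts_of_card_parts_ge μ (by omega) with hs | hs
    · apply hres_ne_one
      funext x
      rw [← hμ, spechtCharacter_of_sortedParts_eq_column μ (by omega) hs,
        Equiv.Perm.mem_alternatingGroup.1 x.2]
      simp
    · have hc : μ.parts.card = n - 1 := by
        rw [← μ.length_sortedParts, hs, List.length_cons, List.length_replicate]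
        omega
      omega
  -- J–L 20.9: `θ|H` is irreducible or a sum of two irreducibles of equal degree
  rcases isIrrChar_restrict_or_of_index_two (alternatingGroup (Fin n)) hidx hθ with
      hirr | ⟨ψ₁, ψ₂, hψ₁, hψ₂, hne12, hdeg, hsum⟩
  · -- non-split: `θ|H = χ`, so `d = f^μ`, and `μ` is neither a row nor a column
    have heq : ρ.character = fun x : ↥(alternatingGroup (Fin n)) => θ x := by
      by_contra hne'
      rw [hχ.classInner_eq hirr, if_neg hne'] at hθne
      exact hθne rfl
    have hdf : (finrank ℂ V : ℂ) = numStandardTableaux μ := by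
      rw [← hχ1, heq]
      exact hθ1
    have hdf' : finrank ℂ V = numStandardTableaux μ := by exact_mod_cast hdf
    have key := linear_le_syt (Y := μ.youngDiagram) (by omega) (by omega) (by omega)
    rw [← hfY, ← hdf'] at key
    omega
  · -- split: `χ ∈ {ψ₁, ψ₂}`, `2 d = f^μ`, `θ` vanishes off `H`, `μ = μᵗ`
    have hχψ : ρ.character = ψ₁ ∨ ρ.character = ψ₂ := by
      by_contra hno
      push Not at hno
      apply hθne
      rw [hsum, classInner_comm, classInner_add_left, classInner_comm ψ₁, classInner_comm ψ₂,
        hχ.classInner_eq hψ₁, hχ.classInner_eq hψ₂, if_neg hno.1, if_neg hno.2, add_zero]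
    have h2d : (numStandardTableaux μ : ℂ) = 2 * finrank ℂ V := by
      rw [← hθ1, ← hχ1]
      have h1 := congrFun hsum 1
      simp only [Pi.add_apply] at h1
      have e1 : θ 1 = θ ((1 : ↥(alternatingGroup (Fin n))) : Equiv.Perm (Fin n)) := rfl
      rw [e1, h1]
      rcases hχψ with h | h <;> rw [h] <;> [rw [hdeg]; rw [← hdeg]] <;> ring
    have h2d' : numStandardTableaux μ = 2 * finrank ℂ V := by exact_mod_cast h2d
    -- `θ` vanishes off `H` (J–L 20.5 equality case: `⟨θ|H, θ|H⟩ = 2`)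
    have hvan : ∀ g : Equiv.Perm (Fin n), g ∉ alternatingGroup (Fin n) → θ g = 0 := by
      rw [← hθ.classInner_restrict_eq_index_iff (alternatingGroup (Fin n)), hidx, hsum, classInner_add_left,
        classInner_comm ψ₁ (ψ₁ + ψ₂), classInner_comm ψ₂ (ψ₁ + ψ₂), classInner_add_left,
        classInner_add_left, hψ₁.classInner_eq hψ₁, hψ₂.classInner_eq hψ₁, hψ₁.classInner_eq hψ₂,
        hψ₂.classInner_eq hψ₂, if_pos rfl, if_neg (Ne.symm hne12), if_neg hne12, if_pos rfl]
      norm_num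
    -- hence `θ · sgn = θ`, i.e. `χ^{μᵗ} = χ^{μ}`, so `μᵗ = μ`
    have htr : spechtCharacter ℂ μ.transpose = spechtCharacter ℂ μ := by
      funext σ
      rw [spechtCharacter_transpose]
      by_cases hσ : σ ∈ alternatingGroup (Fin n)
      · rw [Equiv.Perm.mem_alternatingGroup.1 hσ]
        simp
      · rw [hμ, hvan σ hσ, mul_zero]
    have hμt : μ.transpose = μ := spechtCharacter_injective htr
    have hYt : μ.youngDiagram.transpose = μ.youngDiagram := by
      rw [← Nat.Partition.youngDiagram_transpose, hμt]
    have key := two_mul_le_syt_of_transpose_eq hYt (by omega)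
    rw [← hfY, h2d'] at key
    omega

/-- **Babai–Nikolov–Pyber product mixing in `𝔄_n`, PROVED** (the named fact
`Literature.GroupTheory.QuasirandomGroups.alternatingProductMixing`, via the tree's reduction
`alternatingProductMixing_of_minDegree` to the minimal degree of `𝔄_n`).
[cite: NikolovPyber2011, Cor. 2] [cite: Gowers2008, Thm. 3.3] [cite: JamesKerber1981, Thm. 2.5.15 (i)–(ii)] -/
theorem alternatingProductMixing_of_jamesKerber : Literature.GroupTheory.QuasirandomGroups.alternatingProductMixing :=
  Literature.GroupTheory.QuasirandomGroups.alternatingProductMixing_of_minDegree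
    jamesKerber_minDegree_of_spechtDim


end Literature.RepresentationTheory.FiniteGroups.AlternatingMinimalDegree

end Part6

/-! ## Part 7 — the EXACT discharge(s) -/

/-- **James–Kerber 1981, Thm. 2.5.15 (i)+(ii) HOLDS** — the named fact
`Literature.RepresentationTheory.FiniteGroups.JamesKerber1981_thm_2_5_15` under its discharge name of record: for `n ∉ {3, 4, 5}`,
every irreducible complex representation of `𝔄_n = alternatingGroup (Fin n)` on which some element acts non-trivially has
dimension `≥ n − 1` — Part 6's `AlternatingMinimalDegree.jamesKerber_minDegree_of_spechtDim` (Clifford theory of index two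
over the Specht layer, James–Liebeck 20.5/20.9, and the Specht dimension bounds `SpechtDim.linear_le_syt`,
`SpechtDim.two_mul_le_syt_of_transpose_eq`).  Summits-side twin:
`Summit.ValiantsHypothesis.ValiantsHypothesis.Theorems.OrbitRestorationQPMixingScale.AlternatingMinimalDegree.JamesKerber1981_thm_2_5_15_holds`.
[cite: JamesKerber1981, Thm. 2.5.15 (i)–(ii)] [cite: JamesLiebeck2001, Props. 20.5, 20.9] -/
theorem Literature.RepresentationTheory.FiniteGroups.JamesKerber1981_thm_2_5_15_holds :
    Literature.RepresentationTheory.FiniteGroups.JamesKerber1981_thm_2_5_15 :=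
  Literature.RepresentationTheory.FiniteGroups.AlternatingMinimalDegree.jamesKerber_minDegree_of_spechtDim

/-- **Product mixing in `𝔄_n` HOLDS** — the named fact `Literature.GroupTheory.QuasirandomGroups.alternatingProductMixing` under
its discharge name of record: for `n > 8` and sets `X, Y, Z` of even permutations of `Fin n` with `(n!/2)³ < (n − 1)·|X|·|Y|·|Z|`,
every even permutation is a product `x·y·z` (Gowers 2008 Thm. 3.3 with James–Kerber 2.5.15; Nikolov–Pyber 2011 Cor. 2) —
the tree's reduction `alternatingProductMixing_of_minDegree` fed with `JamesKerber1981_thm_2_5_15_holds` (Part 6's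
`AlternatingMinimalDegree.alternatingProductMixing_of_jamesKerber`).  Summits-side twin:
`Summit.ValiantsHypothesis.ValiantsHypothesis.Theorems.OrbitRestorationQPMixingScale.AlternatingMinimalDegree.alternatingProductMixing_holds`.
[cite: Gowers2008, Thm. 3.3] [cite: NikolovPyber2011, Cor. 2] [cite: JamesKerber1981, Thm. 2.5.15 (i)–(ii)] -/
theorem Literature.GroupTheory.QuasirandomGroups.alternatingProductMixing_holds :
    Literature.GroupTheory.QuasirandomGroups.alternatingProductMixing :=
  Literature.RepresentationTheory.FiniteGroups.AlternatingMinimalDegree.alternatingProductMixing_of_jamesKerber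

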